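import Mathlib
import HarnessLib
import HarnessLib.Audit
import Summits.BirchSwinnertonDyer.Statement
import Summits.BirchSwinnertonDyer.Rank1Residual.WAll.TargetAdditive
import Summits.BirchSwinnertonDyer.BirchSwinnertonDyer.Theorems.KolyvaginRoadThreeKernelHL
import Summits.BirchSwinnertonDyer.BirchSwinnertonDyer.Theorems.AdditiveKolyvaginRoadLevelSystems
import Literature.NumberTheory.GaloisCohomology.PoitouTateSelmerStructures
import Literature.NumberTheory.EllipticCurves.ManinConstantModularDegree
import Literature.NumberTheory.EllipticCurves.ManinConstantSemistablePrimewise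
import Literature.NumberTheory.EllipticCurves.ManinConstantKodairaTypePrimes
import Literature.NumberTheory.EllipticCurves.Isogeny
import Literature.NumberTheory.DiophantineGeometry.TateAlgorithm
import Literature.NumberTheory.EllipticCurves.ManinConstantNonPotentiallyOrdinaryPrimes
import Literature.NumberTheory.EllipticCurves.IsogenyPotentiallyGoodMinimalDiscriminant
import Literature.NumberTheory.EllipticCurves.CasselsTateLevelInputs
import HarnessLib.Audit.Status.Attr

/-!
Route: AdditiveKolyvaginRoad

# Route AdditiveKolyvaginRoad — Kolyvagin's conjecture mod p at an additive prime (infinite slope)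
closes the additive rank-one rows of W-ALL by the horizontal road

It suffices to show X = KOLYVAGIN'S CONJECTURE MOD p AT AN ADDITIVE PRIME p ≥ 5 (crux
`KolyvaginPrimitiveAdditive`): for E/ℚ non-CM of
analytic rank 1 with p² ∣ N, ρ̄_(E,p) onto, W. Zhang's hypothesis ♠ (ord_ℓ Δ prime to p at every
multiplicative ℓ; two multiplicative
primes), p ∤ ∏ c_ℓ, and K a Hoffstein–Luo Heegner field with L(E^(d_K),1) ≠ 0, the bottom Kolyvagin
class c(1) = δ y_K is non-zero
mod p at every Manin-good frame. The additive Kolyvagin kernel (support, the p-generic clone of the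
landed p = 3 kernel) turns X into
BSD_p for the ♯ rank-one additive rows via McCallum ⇒ index lower bound ⇒ Gross–Zagier–Kolyvagin
identity ⇒ `X11b.bsdp_of_indexIdentityAt`;
the complement of the leaf `WAllExclAdditive` (rank 0 at p ≥ 5, rank 1 off ♯, p = 3) is carried by
three DECLARED RESIDUAL cruxes (a fifth crux: Manin-good odd frames exist at additive p) that the
sibling additive routes (K1, K8, K8-tame, K9, W2) attack. No card realised (novel-route seat
bsd-wall-add, lens level-raising).
Lean: `∀ (W : WeierstrassCurve ℚ) [W.IsElliptic] [W.IsGloballyMinimal] [NeZero (W.conductorNorm ℤ)]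
(p : ℕ) [Fact p.Prime] (K : Type) [Field K] [NumberField K] (Dt :
Literature.NumberTheory.EllipticCurves.ModularForms.ModularParametrizationData W (W.conductorNorm
ℤ)) (β : ℤ) (ι : K →+* ℂ), 5 ≤ p → Literature.NumberTheory.EllipticCurves.Rank1Residual.Addv W p →
W.HasSurjectiveModNGaloisRep p → (∀ (ℓ : ℕ) [Fact ℓ.Prime], W.HasMultiplicativeReductionAtPrime ℓ →
¬ p ∣ padicValInt ℓ W.minimalDiscriminantInt) → (∃ (ℓ₁ ℓ₂ : ℕ) (_ : Fact ℓ₁.Prime) (_ : Fact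
ℓ₂.Prime), ℓ₁ ≠ ℓ₂ ∧ W.HasMultiplicativeReductionAtPrime ℓ₁ ∧ W.HasMultiplicativeReductionAtPrime
ℓ₂) → ¬ p ∣ W.tamagawaProduct → W.analyticRank = 1 →
Literature.NumberTheory.EllipticCurves.IsImaginaryQuadratic K → Odd (NumberField.discr K) →
Literature.NumberTheory.EllipticCurves.SatisfiesHeegnerHypothesis (W.conductorNorm ℤ) K →
(W.quadraticTwist (NumberField.discr K : ℚ)).entireLFunction 1 ≠ 0 → (4 * (W.conductorNorm ℤ : ℤ)) ∣
β ^ 2 - NumberField.discr K → ¬ (p : ℤ) ∣ Dt.c → ∃ (n : ℕ) (d :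
Literature.NumberTheory.EllipticCurves.KolyvaginHeegnerData Dt β ι n),
Literature.NumberTheory.EllipticCurves.KolyvaginDescent.KolSupp
(Literature.NumberTheory.EllipticCurves.Zhang2014.IsKolyvaginPrime (W.conductorNorm ℤ) W K p) n ∧
d.kolyvaginClass (Fact.out : p.Prime) 1 ≠ 0`

## Assembly
Pure logic (sorry-free in Sketch.lean, theorem `closes`): fix W, p with ¬CM, p ≠ 2, Addv, r_an ≤ 1.
If p = 3: AdditiveAtThree. Else p ≥ 5
(`Nat.Prime.five_le_of_ne_two_of_ne_three`); if r_an = 0: RankZeroAdditive; if r_an = 1 and the ♯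
conjunction holds: AdditiveKolyvaginKernel
fed with PublishedInputsAdditiveKoly, ManinGoodOddFrameAdditive, KolyvaginPrimitiveAdditive,
RankZeroAdditive; else OffSharpRankOneAdditive.

CLOSES_TARGET: closes rung W-ALL/2 of BirchSwinnertonDyer: Summit.BirchSwinnertonDyer.WAllExclAdditive (D-0061; not the summit Statement) — the deciding theorem of this route concludes that registered leaf instead of the Statement decl `BirchSwinnertonDyer` (class rung: servable and labelled, never counted as concluding the summit Statement).

Rationale: WHY THIS LINE. Every listed additive route is VERTICAL (a main conjecture, a p-adic L-function or
Kurihara numbers AT p, on E or on a twist); this line is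
HORIZONTAL: W. Zhang's induction on the p-Selmer rank by level raising at admissible primes q ≠ p
(WZhang2014 Thms 1.1, 9.1), in which p ∤ N
enters at exactly three places — the finite-flat local condition at p (Lemma 5.1), Diamond–Taylor
level raising / Ihara at l ∤ level
(DiamondTaylor1994), and the rank-zero anchor Thm 7.1 = Skinner–Urban, of which Zhang prints (p.
231) «This is the only place we need to
impose the ordinariness assumption». The transplant to p² ∣ N replaces them by: TYPE-PRESERVING
level raising (arXiv:0810.1877 Cor. 3.1.7:
lifts of prescribed inertial type at p and Steinberg at q) with Ihara / multiplicity one at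
Γ₀(p²q·)-level Shimura curves (arXiv:1907.06043);
ADDITIVE KUMMER-LINE RIGIDITY (the local condition at p of E and of the level-raised A_g agree
inside H¹(ℚ_p, E[p]) because both acquire
good reduction over the same tame field of degree e ∈ {2,3,4,6} and Raynaud's e < p − 1 uniqueness
applies prime-to-p); and a SLOPE-FREE
rank-zero anchor for the level-raised newforms of the same inertial type (Kato2004 divisibility +
the Fouquet–Wan universal-deformation
transfer arXiv:2107.13726, or the rank-zero residual itself for the E-instances). Print has
Kolyvagin's conjecture at p ∤ N ordinary
(WZhang2014), p ∤ N supersingular (Sweeting2020 = arXiv:2012.11771, via Wan), p ∥ N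
(SkinnerZhang2014) — never at p² ∣ N; imported area:
automorphy lifting with prescribed types (Kisin / Gee) and patched Ihara lemmas, not used by any BSD
route of the tree.

RANKED CRUXES. #2 KolyvaginPrimitiveAdditive (crux) — Kolyvagin's conjecture mod p at an additive
prime p ≥ 5 in the ∀-Manin-good-frame ♯ typing of the p = 3 kernel: for every frame (W, p, K, Dt, β,
ι) with 5 ≤ p, Addv W p, ρ̄ onto, ♠(1), ♠(2), p ∤ ∏c, r_an = 1, K imaginary quadratic with odd d_K,
Heegner hypothesis, L(E^(d_K),1) ≠ 0, 4N ∣ β² − d_K, p ∤ c_Manin(Dt): some Kolyvagin–Heegner datum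
of Kolyvagin-prime support has c(1) ≠ 0 in H¹(K, E[p]). [difficulty: open-problem] (why it might
fail: the rank-0 anchor for level-raised forms of additive type at p is Skinner–Urban territory at
infinite slope (open); type-preserving level raising may miss BD-admissibility; Kummer lines of
congruent A_g may differ at (p,e) ∈ {(5,4),(5,6),(7,6)}.) [WZhang2014, arXiv:0810.1877,
arXiv:1907.06043, arXiv:2107.13726, Kato2004, Sweeting2020, SkinnerZhang2014, Kolyvagin1991,
BertoliniDarmon2005] SPLIT BY LOCAL TYPE (tenure rev 6, gen 1, glue KolyvaginPrimitiveAdditiveGlue ✓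
proved via `Rank1Residual.Additive.sub_exhaustive`): #2a KolyvaginPrimitiveAdditiveAbelianType (crux
r201; binder `SubM W p ∨ SubGord W p` = ρ_{E,p}|G_p semistable over an abelian tame extension;
skeleton Cruxes/KolyvaginPrimitiveAdditiveAbelianType/Lines/birth.lean REGISTERED v4 (tenure g6,
commit 5f421462fb89, rc 0 · 4 sorries = stubs: P · `stub_baseCaseAbelianTypeV2` (#Sel = p ⇒ c(1) ≠ 0
on the abelian locus, twisted-pair mechanism in the docstring) · KS-AB
`stub_levelKolyvaginSystemsAbelianType` (the lead's KS restricted to SubM ∨ SubGord: Raynaud line /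
ordinary filtration in families, Kisin–Gee BT lifts of fixed tame type arXiv:0810.1877 Cor. 3.1.7) ·
LOC verbatim; ENGINE by name); crux idea `twisted-brandt-bottom`: on e = 2 the bottom is W. Zhang's
base case for the SEMISTABLE pair (E′ = E⊗χ_{p*}, χ_K = χ_{p*}∘N) — semistable level raising S′ ∘
twisted rank-0 anchor A′ (`TwistedAnchor`, the one open input = #3 in twisted currency) ∘ first
reciprocity with character B′ ∘ twist transport T′ (E′(H_p)^{χ_K}⊗ℚ = E(K)⊗ℚ; ord_p of the CST Thm
1.1/1.5 constant ratio to be COMPUTED), over the tree's Brandt stack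
BrandtXi/GrossPoints/GrossPointsPicardAction) and #2b KolyvaginPrimitiveAdditiveNonAbelianType (crux
r202; binder `SubTprime W p ∨ SubW W p`; its object LANDED 2026-08-27 (defn-CuspidalTypeBrandtModule
DONE): `Literature/NumberTheory/Automorphic/BrandtCuspidalTypeForms.lean`
(`Brandt.CuspidalTypeSetupLite p N⁺ N⁻`, type lattices, `cuspidalTypeBrandtModuleLite`) +
`Literature/NumberTheory/EllipticCurves/CuspidalTypeBrandtModule.lean` (`cuspidalTypeBrandtModule W
S A σ` = the E-eigenspace of quaternionic forms of the cuspidal type Θ(θ), θ of order e ∤ p − 1,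
level (N/p², q); `piRepMap` change of coefficients; multiplicity one NOT asserted — it is this
child's open content); skeleton Cruxes/KolyvaginPrimitiveAdditiveNonAbelianType/Lines/birth.lean
REGISTERED v2 (tenure g6, commit c0d4a20ae82b, rc 0 · 4 sorries = stubs: P ·
`stub_bottomNonAbelianType` (bottom on SubTprime ∨ SubW, to be re-cut over
`cuspidalTypeBrandtModule`: supply at an admissible q in type σ ∘ anchor ∘ reciprocity — the lead's
call) · KS-NA `stub_levelKolyvaginSystemsNonAbelianType` (no canonical line, no printed R = T in
fixed supercuspidal type at p²-level) · LOC verbatim; ENGINE by name). KS of the parent (type-free)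
⟸ KS-AB ∧ KS-NA by `Rank1Residual.Additive.sub_exhaustive`. The parent stays claimable at low
priority — lead line `birth` v9 (skeleton of record since 2026-08-27 19:04Z,
Cruxes/KolyvaginPrimitiveAdditive/Lines/birth.lean sha16 648fc31848a5ae08 = the v8 stubs (commit
82668591ee93, 14:23Z) re-typed with the R-K4 clause; FOUR stubs: parity P
`stub_oddSelmerRankAdditive` (landed modulo PUB, p507430) · ONE mechanism-free bottom stub BOT
`stub_bottomRankOneAdditive` (the S∘A∘B cut is false as typed on the flat locus (5, II*), see memo;
the mechanisms live in the two children) · level Kolyvagin systems KS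
`stub_levelKolyvaginSystemsAdditive` (open at p² ∣ N — the research content) · local package LOC
`stub_kolyvaginLocalPackageAdditive` (defs p527353 ✓; REDUCED to (Supply) ALONE at a Kolyvagin
prime: p533303 ✓ `…LocalPackageOfKolyvaginPrime`, p535599 ✓ `…KolyvaginTransverseIsotropy`, p536240
✓ `…KolyvaginGrossBridge`, p540159 ✓ `…KolyvaginPerf` ((Perf) PROVED: local Tate duality at a
Kolyvagin prime), p540947 ✓ `…LocalPackageOfSupply`
(`AdditiveKoly.kolyvaginLocalPackageP_of_supply`); (Supply) is PORTED to general odd p modulo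
Poitou–Tate by the akr-p1 lineage — p542338 ✓ IsoBoundCore, p544277 ✓ CupNonvanishing, p546163 ✓
IsoBound, p547100 ✓ hw, p547854 ✓ Lagrangian transversality, p549206 ✓ ConjStable, p549599 ✓ Toric,
p557209 ✓ SignedSupply, p558820 ✓ JumpStructures, p561938 ✓ Jump, p562934 ✓
`Theorems/AdditiveKolyvaginRoadKolyvaginSupplyOfPoitouTate.lean` (LOC modulo Poitou–Tate) — the
global half being Poitou–Tate duality for Selmer structures
`Literature.NumberTheory.GaloisCohomology.poitouTate_selmerStructure_duality`, PUBLISHED, carried as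
a hypothesis by #9-DUAL, never asserted); Zhang's §9 induction ENGINE is PROVED — p534939 ✓
`…Theorems.AdditiveKoly.stub_inductionOfLevelSystemsAdditive` — and cited by name inside the
composition `KolyvaginPrimitiveAdditive_of`). Memo HOME/bsd-wall-add/memo-multOne-v1.md (v1.2): the
v5 datum field `multOne` at level K₀(p²)M is EMPTY on the flat locus (5, II*) and unfounded on every
other additive cell (≥ 2 inertial types per cell).
PROMOTION (tenure g7, lead akr-p1 g3 handback `promote-stub`, revs 17–18): the two OPEN stubs of
line `birth` v8 are now ITEMS with the v8 statements verbatim — #8 LevelKolyvaginSystemsAdditive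
(crux; KS = `Nonempty (LevelKolyvaginSystemP W K p Dt β ι c)` at every ♯ additive frame: Zhang Thm
4.3 transport + Thm 7.2 base case at non-empty levels for the level-raised forms OF E's ADDITIVE
TYPE; the research content; in print only at p ∤ N / p ∥ N, at p² ∣ N only the Fouquet–Wan PREPRINT
arXiv:2107.13726 Cor 1.10/5.4 on its (Lgl)/non-split-Steinberg locus; Ihara at p²-level IS in print,
Manning–Shotton 2021 Thm 1.1; multiplicity one only on the EGS-generic locus; period bridge
unprinted — tenure memo Cruxes/LevelKolyvaginSystemsAdditive/MEMO-anchor-v1.md) [WZhang2014,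
arXiv:2107.13726, arXiv:1907.06043, arXiv:0810.1877, arXiv:1305.1594], #10 BottomRankOneAdditive
(crux; BOT = #Sel_p(E/K) = p ⇒ c(1) ≠ 0: Kolyvagin's conjecture at the bottom, the same rank-0
anchor at the lowest level) [WZhang2014, SkinnerZhang2014, arXiv:2107.13726, GrossLMS1991], #9
KolyvaginPrimitiveOfLevelSystemsAdditive (support; THE E-SIDE COMPOSITION PUB → DUAL → KS → BOT →
#2: parity P ✓ `oddSelmerRankAdditive_of_published`, rank lowering A1 ✓, ENGINE ✓, LOC ⟸ (Supply)
p540947 with (Supply) in port by the akr-p1 lineage (IsoBound p546163 ✓, hw p547100 ✓, Lag-tr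
p547854 ✓, ConjStable p549206 ✓, Toric p549599 ✓, Signed p557209 ✓, parity-from-levelwise-CT p557719
✓ `…KolyvaginPrimitiveAdditiveParityOfLevelInputs`, JumpStructures p558820 ✓, Jump p561938 ✓,
SupplyOfPoitouTate p562934 ✓) — that lineage's closing target (lead akr-p1 g4, item 21266), by
importing the skeleton's `KolyvaginPrimitiveAdditive_of`; CLOSED ✓ p566703 — since then, by the
kernel-checked `closes`, the road's open E-side content is exactly #8 ∧ #10 (KPA′ #2 ⇐ PUB ∧ DUAL ∧
KS′ ∧ BOT′), next to #7R and the residuals #3 #4 #5), #9 PublishedDualityInputsAdditiveKoly (support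
BY NAME, T12: the LEVELWISE Cassels–Tate inputs `∀ K, casselsTate_levelInputs K` (explicit binder —
the p = 3 road's form, item ShimuraCasselsTateLevelInputs; restated at rev 18 from the all-levels
closed fact `exists_casselsTate_pairing`, which is cite_only and had flipped the route unstaffable
at rev 17) ∧ Poitou–Tate duality `∀ K, poitouTate_selmerStructure_duality K`, both PUBLISHED, one
item under the 15-cap; the composition's prover re-derives parity P from the levelwise inputs
exactly as `stub_oddSelmerRankAtThree_of_casselsTateLevelInputs` does at p = 3). Since rev 18
`closes` ASSUMES #8, #10, #9, #9-DUAL and DERIVES #2 (`have h₁ := hOf hP hDual hKS hBOT`); #2 stays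
in the cone (glue-used), claimable, the --supports target of the E-side port; its by-type children
#2a/#2b are legacy carriers after the promotion (their type-restricted KS/BOT stubs become the stubs
of the by-type skeletons of #8/#10; do not staff them). Load-bearing OPEN cruxes after the
promotion: #8, #10, #7R, and the residuals #3 #4 #5. R-K4 (director W-26, variant A; revs 19–20,
2026-08-27 19:01:50Z, answering Q-K4 of rev 18): #2/#2a/#2b/#8/#10 now read «… → Odd
(NumberField.discr K) → NumberField.discr K < -4 → …» — K = ℚ(√−3) (u_K = 3) is excluded because the
landed general-p transverse / Gross–Zagier–Kolyvagin normalisations and the Kernel's own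
Hoffstein–Luo frames have d_K < −4; 1:1 restates, decl names kept, texts otherwise verbatim, items
21400 / 21398 / 21399 / 21396 / 21397 supersede 20132 / 20418 / 20419 / 21264 / 21265, all five
re-stamped 19:04Z; Kernel re-landed p561799 ✓ with the clause threaded (`hlt`), Glue ✓ untouched;
skeletons of record #2 v9 648fc31848a5ae08, #8 40d1c84848fd227f (by-type stubs AB ∕ NA, composed by
`sub_exhaustive`), #10 v2 61bdb1c52ccb48ab (lead akr-p3 reshape 20:17Z of the desk's
4f4f6217a1fb9416: the cohomology-to-point layer `stub_kolyvaginClassOneOfNotPDiv` — McCallum Cor.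
4.5 ∘ Gross Lemma 4.3 / Prop. 3.6 at conductor 1 ∘ Darmon Thm 3.6, proved in the lead's file and
landing --supports — plus two OPEN stubs in POINT currency,
`stub_heegnerPointIndivisibleAbelianType` (SubM ∨ SubGord) ∕
`stub_heegnerPointIndivisibleSupercuspidalType` (SubTprime; SubW is empty at p ≥ 5): ♯ frame ∧
#Sel_p(E/K) = p ⇒ P(1) = y_K ∉ p·E(K[1]) for every conductor-1 datum = the rank-one BSD_p LOWER
bound for E/K at an additive p; vet akr3 STAMP ×6 on the rev-20 texts 20:21Z, KS′ junk/forcing audit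
kernel-checked: `Nonempty (LevelKolyvaginSystemP …)` is not degenerate-satisfiable at any consumer
frame — content = `baseCase` + `relation`/`transverse_on`, memo VET-AKR3-g0.md efefdaf83e6e2db8);
cross-route importers of the five decls notified (addord `…GordTwoRankOneHeegnerKolyvaginHorizontal`
+ 3 importers, re-threaded by their owner). STAFFING (D-0145 (71), 19:52Z): LEAD akr-p2x on #8 and
LEAD akr-p3 on #10 in LINE mode on those skeletons — abelian-type stub first (printed inputs modulo
by-name facts: Diamond–Taylor Thm A, Chebotarev, Zhang 2014 Thm 4.3 / (4.8) / Thm 7.2, the e = 2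
twist-anchor census); the non-abelian stubs (the unprinted rank-0 anchor (γ) and period bridge (δ)
at p² ∣ N for supercuspidal type) are the crux-ideation object on #8 — dossier
`Cruxes/LevelKolyvaginSystemsAdditive/DOSSIER-INDEX.md` ∕
`Cruxes/BottomRankOneAdditive/DOSSIER-INDEX.md`; #9 OfLS CLOSED by LEAD akr-p1 g4 (p566703 ✓,
20:37Z) and #2 released open — nothing is provable on #2 itself until #8 / #10 move. LEAD akr-p2x on
#8 (20:28Z): `realisation` is supplied UNCONDITIONALLY (p566745, Kolyvagin–Heegner data at every
Kolyvagin conductor from the proved CM facts); «the bottom is inside the level system» (p567709: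
`LevelKolyvaginSystemP.exists_kappa_empty_ne_zero_of_pair`,
`kolyvaginPrimitive_of_levelSystem_of_rankOne` = KS′-datum ∧ (J2) ⇒ the KPA′ conclusion at
#Sel_p(E/K) = p, (J2) = the two-prime Poitou–Tate jump, E-side Galois cohomology of the landed A1 /
(Supply) / jump family, to be landed --supports, never an item); pen rule: WHEN a BOT′-free glue
`PublishedInputsAdditiveKoly → PublishedDualityInputsAdditiveKoly → LevelKolyvaginSystemsAdditive →
KolyvaginPrimitiveAdditive` is PROVED in Theorems, `closes` is re-certified without `hBOT` and #10
re-kinded support (its point-currency stubs remain the s = 1 witness); carrier audit (lead + vet,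
kernel-checked): no junk inhabitant — `transport` at level ∅ with `baseCase` at the rank-one 2-prime
levels encodes Kolyvagin's conjecture for E, and abstract Mazur–Rubin ∕ Howard existence at n ≠ ∅
would reduce KS′ to KPA′ itself, so a line for #8 must be GEOMETRIC at the 2-prime levels.
#3 RankZeroAdditive (crux) — RESIDUAL (imported complement, attacked by the sibling routes
AdditiveBranchIMC / QuadraticBranchSignedControl / KatoDescentTamePotSupersingular /
KatoDescentPotSupersingular): BSD_p for every non-CM E/ℚ of analytic rank 0 at every additive prime
p ≥ 5. It is also consumed INSIDE the kernel (the twist E^(d_K) has rank 0 and the same additive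
type at p). [difficulty: open-problem] (why it might fail: it cannot fail as mathematics short of
¬BSD; as a WORK ITEM it is the whole rank-0 additive lower half (Kato gives only ≤; equality at pot.
supersingular e ∈ {3,4,6} and at pot. multiplicative p has no printed proof).) [Kato2004,
Delbourgo1998, Delbourgo2002, arXiv:2505.09121, arXiv:2107.13726]
#4 OffSharpRankOneAdditive (crux) — RESIDUAL: BSD_p for the non-CM rank-one additive rows at p ≥ 5
OFF the ♯ locus (ρ̄_(E,p) not onto, or ♠ fails, or p ∣ ∏ c_ℓ) — the rows no Heegner-point Kolyvagin
argument in print reaches (Jetchev: p ∣ c_ℓ forces extra divisibility of y_K). [difficulty: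
open-problem] (why it might fail: as a work item it contains the Eisenstein additive rank-one rows
(ρ̄ reducible, p ≥ 5: p = 5, 7 only by Mazur) and the p ∣ c_ℓ rows where Kolyvagin's c(1) DOES
vanish mod p (Jetchev2008), so the road itself cannot serve it.) [Jetchev2008, WZhang2014,
GrossZagier1986, Kolyvagin1991]
#5 AdditiveAtThree (crux) — RESIDUAL: BSD_3 for every non-CM E/ℚ of analytic rank ≤ 1 with additive
reduction at 3 (wild e ∈ {6,12,…} and tame) — the territory of KimAtThreeKolyvagin /
KatoDescentPotSupersingular / AdditiveBranchIMC; excluded from the road because Zhang's hypotheses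
need p ≥ 5 (tower surjectivity, Lemma 5.3). [difficulty: open-problem] (why it might fail: as a work
item: wild ramification at 3 (conductor exponent up to 5), no finite-flat models over a tame field,
ρ̄_(E,3) onto does not propagate to 3-power level; no printed BSD_3 formula in rank 1 at additive
3.) [arXiv:2505.09121, Kato2004, Delbourgo1998, WZhang2014]
#6 ManinGoodOddFrameAdditive (crux r6, a DERIVED node never to be staffed directly — `closes`
constructs it from the proved gen-2 glue, the class items and #7R; tenure g7 parked it as support
(rev 15) and aside (rev 16) to pass the 7-crux / 15-item caps for the promotion package, and the
gate re-promoted it to crux at rev 17 because it is in the cone) — MANIN-GOOD ODD FRAMES EXIST: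
given the published inputs (Hoffstein–Luo, newforms), at every additive p ≥ 5 with E[p] irreducible
and r_an = 1 there is a Hoffstein–Luo field K (d_K ≡ 1 mod 8 odd, every ℓ ∣ N split, p ∤ d_K,
L(E^(d_K),1) ≠ 0, w_K prime to p), a modular parametrisation of W with Manin constant PRIME TO p,
its Heegner point y_K ∈ E(K) and a minimal model of the twist — the shape of
`X11b.exists_oddHeegnerData` without `Mult`. SPLIT (rev 2, Edixhoven 1991 Thm 3 pinned):
ManinEdixhovenInputs (support, the named facts
`edixhoven_not_dvd_maninConstant_of_not_potentiallyGoodOrdinary` ∧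
`edixhoven_not_dvd_maninConstant_of_kodairaSymbol_ne` ∧
`integral_neronScaling_of_isGloballyMinimal`) → ManinFrameOffEdixhovenException (support, PROVABLE
NOW: p ≥ 11 off (potentially good ordinary ∧ ord_p Δ_min ≤ 4), Edixhoven at the strong curve +
prime-to-p isogeny transport as in GordManinConstant.lean /
`X11b.exists_modularParametrizationData_not_dvd`) → ManinFrameOnEdixhovenResidue (crux: the OPEN
residue p ∈ {5,7} ∪ (p ≥ 11 ∧ pot-ordinary Kodaira II/III/IV) = Manin's conjecture p-part; owner:
the Manin census row, instance-closable per curve by Cremona's c = 1 tables) → #6 (glue, pure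
logic). [deps: PublishedInputsAdditiveKoly] [difficulty: M off the residue / open-problem on it]
(why it might fail: only on the Edixhoven residue — p ∈ {5,7} (Edixhoven's method allows 5, 7 ∣ c)
and p ≥ 11 pot-ordinary of type II/III/IV (Edixhoven 1991 Thm 3: p ∣ c at most once; Mazur needs p²
∤ 4N, Česnavičius 2018 is semistable, CNS bound c by deg φ and p ∣ deg φ at congruence primes).)
[EdixhovenManin1991, HoffsteinLuo1997, arXiv:1911.09446, AgasheRibetStein2006, Cesnavicius2018,
Darmon2004, arXiv:1604.02165] STATUS (rev 5 resplit gen 2, k = 8; rev 10–11 re-wiring):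
ManinFrameOffExceptionClass ✓ (p506620), ManinFrameIstarClass ✓ (p512355/p513665), glue
ManinGoodOddFrameAdditiveResplitGlue ✓ (p514292); the residue child ManinFrameResidueClass (20094)
is SUPPORT since rev 11 — superseded at the deciding theorem, which derives it by pure logic (the
derivation is also a citable lemma since p533053:
`…Theorems.ManinFrameResidueClass.maninFrameResidueClass_of_items :
CesnaviciusNeururerSahaManinDegree → ManinFrameResidueDegreeClass → ManinFrameResidueProper →
ManinFrameResidueClass`; the 7-binder `Assembly` 20139 ✓ stays proved by the same FQN, its file
re-landed closes-free p532570) from ČNS (#9 CesnaviciusNeururerSahaManinDegree, by name) ∧ #9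
ManinFrameResidueDegreeClass (degree-free sub-locus, closable by
`…ManinFrameResidueClass.frame_of_degreeClass`, p523401) ∧ #7 ManinFrameResidueProper, and then #6
by the proved glue; `closes` binds the proved / by-name children directly (the gate renderer cannot
yet re-split a family with proved survivors — tenure g4, director (19)). OPEN: #7 (as
ManinFrameResidueProperR since the T10 plumbing) and the six by-name fact supports.

#7 ManinFrameResidueProper (crux) — THE PROPER MANIN RESIDUE (= hypothesis hProper of the landed
`…ManinFrameResidueClass.maninFrameResidueClass_of_cns_of_proper`, p523401): for frames (W, p) with
p ≥ 5 additive, E[p] irreducible, on the Edixhoven exception class with no Iₙ* member, r_an = 1, and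
such that EVERY modular parametrisation datum of EVERY minimal W' ~ W at level N(W) has p ∣ deg —
equivalently p ∣ deg φ₀ at the X₀(N)-optimal curve
(`…ManinResidueDegreeOptimal.forall_dvd_modularDegree_iff_dvd_optimal`, p528365) — a Manin-good odd
Heegner frame exists. This is the p-part of Manin's c = 1 exactly where print is silent: p² ∣ N
voids Mazur / Abbes–Ullmo, types II/III/IV pot-ordinary or p ≤ 7 are Edixhoven's exceptions, p ∣ deg
φ voids Česnavičius–Neururer–Saha; 55.6 % of the ♯ residue keys N < 5·10⁵ (census
CENSUS-ADDITIVE-R1, d70ffdc336a9f529), true curve-by-curve in Cremona's tables. EQUIVALENTLY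
(p531398 `…Theorems.ManinFrameResidueProper.maninFrameResidueProper_of_optimalManin` /
`not_dvd_optimal_c_of_maninFrameResidueProper`, granted PUB conj. 6–7): Manin's p-part p ∤ c₀ at the
lattice-optimal data of the X₀(N)-optimal curves of the proper residue. LINE `birth` REGISTERED
(Cruxes/ManinFrameResidueProper/Lines/birth.lean, v3 since 13:51Z: both stubs carry the newforms
fact `exists_isNewformOf` as first binder; seat bsd-wall-manin-p1 holds the item since 14:1xZ): two
research stubs by residue prime range = the literature's cut — `stub_memberManinUnit_fiveSeven` (p ∈
{5,7}: some minimal member has a datum at level N(W) with p ∤ c) and `stub_memberManinUnit_ordinary`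
(p ≥ 11 pot-ordinary II/III/IV: the same; Edixhoven's «at most once» sharpened to «never»), neither
using r_an = 1, composed to the crux by the landed partner transport (p521337) and Hoffstein–Luo
frame (`ManinFrameFromDatum`). FIRST RUNG (BC5): the crux RESTRICTED TO CONDUCTOR ≤ 5·10⁵ holds
modulo Cremona's theorem c₀ = 1 taken by name
(`cremona_abs_maninConstant_eq_one_of_level_le_500000`; LANDED p534837 ✓
`…Theorems.ManinFrameResidueProperCremonaRange.maninFrameResidueProper_of_conductorNorm_le`, helper
of 20483) — so the open content is literally N > 5·10⁵ on the proper residue; for the p ≥ 11 stub at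
the optimal member the wanted input is Edixhoven's Utrecht thesis (1989/90; «only 2, 3, 5, 7 can
divide c», reported as unpublished in AgasheRibetStein2006 §2; acq-13032 open), which (manin-p1,
memo Lines/birth-S11-verdict.md 666552e60b1e) CANNOT close the p ≥ 11 stub — Edixhoven 1991 Thm 3 is
already STRONGER than thesis Thm 4.6.3, so the thesis is wanted only for E-independent bounds at p ∈
{5,7} — PRINTED CEILING (memo Cruxes/ManinFrameResidueProper/MEMO-ceiling-v1.md, 3651056371ae):
PastenShimura2024 [corpus:paper:arxiv-1705.09251 p.4, p.33] «in general it is not clear how to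
control the Manin constant beyond the semi-stable case», Thm 1.3/10.1/10.3 bound v_p(c_f) ≤ μ_{S,p}
without vanishing, and his n. p.33 reports the thesis claim as Edixhoven's «strategy that seems
promising»; so both stubs are open in print and the ceiling-lift is the crux itself. MANIN-FREE
TRANSLATION LANDED (seat manin-p1, 2026-08-27): p540328 ✓
`…Theorems.ManinFrameResidueProperTwistDegree` — granted Edixhoven Thm 3 at the STARRED p*-twist
(off the exception) and Dokchitser–Dokchitser 2015 Thm 5.1(1) (v_p Δ_min is invariant under
prime-to-p isogeny), «some minimal member has p ∤ c» at p ≥ 11 is EQUIVALENT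
(`exists_member_not_dvd_c_iff_twistDegreeStep`) to the TWIST-DEGREE STEP TDS: for the unstarred
(G)-ordinary minimal member V and the minimal model W♭ of V ⊗ χ_{p*}, some conductor-level datum of
V has v_p(deg) below that of every conductor-level datum of W♭ (print: v_p deg φ̃ = v_p deg φ + 1 +
2 v_p(c̃/c), p ∤ c̃ — Edixhoven §4; census: deg♭ = p·deg on all 85 108 (G)-ord optimal pairs N <
5·10⁵); p542525 ✓ lattice form (Λ_f ⊆ g(χ_p)·Λ_{f⊗χ_p}: a ONE-LEVEL modular-symbol test); p543866 ✓
the crux by name from S57 + TDS + the three facts (proof.conditional). T10 PLUMBING (tenure g6):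
because TDS ⟹ S11 consumes three printed theorems the crux text does not carry (the two Edixhoven
renderings = items EdixhovenManinNonPotOrdinary / EdixhovenManinKodairaType, and DD2015 5.1(1),
stated by no item), the served crux is RESTATED ONCE as ManinFrameResidueProperR :=
EdixhovenManinNonPotOrdinary → EdixhovenManinKodairaType → DokchitserIsogenyMinimalDiscriminant →
(this text verbatim), consumed by `closes` in its place (this decl stays in the file, aside, for
p531398 / p534837 / the registered line; it implies R trivially); R's registered line has the stubs
S57 (verbatim) and TDS `stub_twistDegreeStep`. [deps: PublishedInputsAdditiveKoly] [difficulty: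
open-problem] (why it might fail: it IS Manin's conjecture (p-part) on the residue; a single optimal
curve with p ∣ c₀, p ≥ 5 additive, p ∣ deg φ₀ kills it as typed (none known; c₀ = 1 for all optimal
curves of conductor ≤ 5·10⁵ by Cremona/ARS).) [EdixhovenManin1991, CesnaviciusNeururerSaha2023,
AgasheRibetStein2006, Cesnavicius2018]

#7 ManinFrameResidueProperR (crux) — = ManinFrameResidueProper GRANTED its printed antecedents
(Edixhoven 1991 Thm 3, both tree renderings; Dokchitser–Dokchitser 2015 Thm 5.1(1)): the item
`closes` consumes since the T10 plumbing. Open content: p ∈ {5,7} — Manin's p-part for some minimal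
member of the class (S57); p ≥ 11 — the Manin-free twist-degree step TDS (Edixhoven's §4 case 1,
v_p(c) = 1 with deg♭ = deg/p, never occurs for pot-ordinary II/III/IV optimal curves). [deps:
EdixhovenManinNonPotOrdinary, EdixhovenManinKodairaType, DokchitserIsogenyMinimalDiscriminant,
PublishedInputsAdditiveKoly] [difficulty: open-problem] (why it might fail: it IS Manin's conjecture
(p-part) on Edixhoven's exceptional locus; TDS is open in print (ČNS 2024 §1) and true only
curve-by-curve (Cremona).) [EdixhovenManin1991, CesnaviciusNeururerSaha2023, AgasheRibetStein2006,
DokchitserDokchitser2015LocalInvariants, Cesnavicius2018] PARTIAL ON A SUB-LOCUS (seat manin-p1 g3,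
K4-free TAME-TWIST lever, helpers --supports 20709: p561676 ✓
`…ManinFrameResidueProperRTameTwistArith`, p562008 ✓ `…RTameTwistGamma0`, p563238 ✓
`…RTameTwistSplit`, p563901 ✓ Literature fact
`Literature.NumberTheory.EllipticCurves.kato_neron_isIntegral_twistedSymbolSum_of_additive` (F′, all
odd characters, statement-only), p564549 ✓ `…RTameTwistCharacter`, p566277 ✓ `…RTameTwistMod4`;
pending `…RTameTwistSymbols`, `…RTameTwistSplit4`; staged rc 0: `…RTameTwist` MAIN
`twistDegreeStep_of_tameTwist` = stub TDS on the sub-locus (A²) := ∀ ℓ ∥ N(W), no 2-power of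
ℓ/a_ℓ(W) ≡ 1 (mod p), and `…RTameTwistPlus` under the weaker (A⁺) := ℓ ≢ ±a_ℓ (mod p), both
conditional on F′ taken by name; census over the 458 register cells with p ≥ 11
(census/tame_twist_locus.py): (A²) 324 = 70.7 %, (A⁺) 424 = 92.6 %, (A) [only ℓ ≡ a_ℓ excluded] 442
= 96.5 %; of the 9 outside-print cells 4 ∕ 7 ∕ 8, the one outside (A) being 462215e1@13; a
hypothesis-free lever (quadratic-residue conditions (ℓ/d′) = ∓1 carried through the γ-splitting) is
being typed — if it types, TDS ⟸ F′ at EVERY frame with p ≥ 11. F′ is NOT a binder of #7R (binders: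
the two Edixhoven items, Dokchitser, PUB); adding it = a new item on a route at its item cap, a
director decision deferred until the lever types; cap-neutral plan of record: a second LINE
`tame-twist` on #7R with skeleton {`stub_memberManinUnit_fiveSeven` (S57),
`stub_katoNeronTwistedSymbolSum : F′` (published, XL, never a grant)} composed through p540328,
registered by the pen on handover).
#9 DokchitserIsogenyMinimalDiscriminant (support) — BY NAME, cite-only: Dokchitser–Dokchitser,
«Local invariants of isogenous elliptic curves» (TAMS 367, 2015) Thm 5.1(1), clause l ≠ p: an
isogeny of degree prime to p preserves v_p(Δ_min) at a prime of potentially good reduction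
(`Literature.NumberTheory.EllipticCurves.dokchitser_padicValInt_minimalDiscriminantInt_eq_of_isogeny_of_not_dvd_degree`,
PUBLISHED). [difficulty: hypothesis-only] [DokchitserDokchitser2015LocalInvariants]
#9 PublishedInputsAdditiveKoly (support) — the conjunction of the tree's NAMED published facts the
kernel consumes (Gross–Zagier, Kolyvagin, Kolyvagin's Ш-bound, GZK rank over ℚ, modularity,
newforms, Hoffstein–Luo, Galois-conjugation of the conductor-1 Heegner point, McCallum's structure
theorem, Darmon Thm 3.6) — hypotheses, never asserted. [difficulty: provable-now] [GrossZagier1986,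
Kolyvagin1991, McCallumLMS1991, HoffsteinLuo1997, Darmon2004]
#9 CesnaviciusNeururerSahaManinDegree (support) — BY NAME, cite-only: Česnavičius–Neururer–Saha,
v_p(c(D)) ≤ v_p(deg D) for every parametrisation datum at level N(W), p ≥ 5
(`…ModularForms.cesnaviciusNeururerSaha_padicVal_maninConstant_le_modularDegree`). [difficulty:
hypothesis-only] [CesnaviciusNeururerSaha2023]
#9 ManinFrameResidueDegreeClass (support) — the residue frame on the DEGREE-FREE sub-locus (some
minimal W' ~ W has a datum at level N(W) with p ∤ deg), modulo ČNS; 44.4 % of the ♯ residue keys;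
CLOSED ✓ (p530987 `…Theorems.ManinFrameResidueDegreeClass.maninFrameResidueDegreeClass_proof`, over
p523401 `frame_of_degreeClass` and the Irr-transport p521337). [difficulty: provable-now]
[CesnaviciusNeururerSaha2023, HoffsteinLuo1997]
#9 AdditiveKolyvaginKernel (support) — the ADDITIVE KOLYVAGIN KERNEL: published inputs → Manin-good
odd frames → the crux → the rank-zero residual → BSD_p for every ♯ rank-one additive row at p ≥ 5
(p-generic clone of the landed p = 3 kernel `Koly.bsdp_three_onA1_of_kolyvaginFramesHL`: frame ∘
Darmon 3.6 datum ∘ GZ non-torsion ∘ Kolyvagin ∘ E(K)[p] = 0 ∘ crux ∘ McCallum ⇒ IndexLowerBoundAt ⇒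
identity ⇒ `X11b.bsdp_of_indexIdentityAt`, the twist's p-part from the rank-zero residual via
`pPart_of_bsdp`). [difficulty: L] [WZhang2014, McCallumLMS1991, GrossZagier1986, Kolyvagin1991,
Miller2011LMS]

TWO-LAYER PLAN. EXECUTED at rev 6: KolyvaginPrimitiveAdditive ⇐
KolyvaginPrimitiveAdditiveAbelianType ∧ KolyvaginPrimitiveAdditiveNonAbelianType (glue proved).
Inside the abelian child the registered skeleton is base case (`stub_baseCaseAbelianType`,
#Sel_p(E/K) = p ⇒ c(1) ≠ 0) → parity P → rank lowering A1 (reduced to five local-global inputs by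
p511644) → induction S2′; the base case itself is cut S′/A′/B′/T′ by the crux idea
`twisted-brandt-bottom` (stubs, not items — no third layer). The non-abelian child's definition item
has landed and its v8-shaped skeleton is staged; a second decomposition of it would be a new route,
not a third layer here. The Manin node keeps its gen-2 family; its residue is carried by the
top-level items #7 / #9 (no third layer: the deciding theorem does the gluing).

KILL CRITERIA. (1) THEORETICAL: a proof that at some additive (p, e) with p ≥ 5 NO BD-admissible
prime q admits a type-preserving level raising of f_E mod p (Diamond–Taylor/Gee local conditions at
p²-level incompatible with admissibility), or that the mod-p multiplicity-one / Ihara input fails at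
Γ₀(p²M) for the definite quaternion algebra — either kills stub_selmerRankOne's mechanism and forces
the pivot to the Kato–Kurihara (modular-symbol) Kolyvagin system of arXiv:2505.09121 on the same
rows; (2) COMPUTATIONAL, ONE-SIDED (J's RUNG-1): a ♯ additive frame (p = 5, 25 ∣ N, N > 5000, r_an =
1, ρ̄ onto, ♠, 5 ∤ ∏c_ℓ, Hoffstein–Luo K) with M₀ = ord_5 [E(K) : ℤ y_K] ≥ 1 at which the derived
classes c₁(n) are CERTIFIED zero for all Kolyvagin levels n up to the bound where McCallum's
structure theorem forces a non-zero one (i.e. a certified M_∞ > 0) refutes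
KolyvaginPrimitiveAdditive at that frame: close `refuted:KolyvaginPrimitiveAdditive`. NOT a kill (J,
round 1): «BSD-predicted ord_p #Ш(E/K) vs ord_p [E(K) : ℤ y_K]» — that comparison is an IDENTITY by
the proved Gross–Zagier formula (Gross 1991 §2) and cannot see whether some c₁(n) ≠ 0. The sibling
routes closing WAllExclX3 ∧ WAllExclX4 class-wide moot the route (`wAllExclAdditive_iff`). UPDATE
(tenure g3, memo-multOne-v1 v1.2): criterion (1), second clause, is REALISED ON A SUB-LOCUS —
multiplicity one at Γ₀(p²M) fails for every candidate φ on the flat locus (5, II*) (ρ̄ flat ⇒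
Khare–Wintenberger weight-2 lift of level prime to p ⇒ two independent p-old degeneracy images in
the definite space, Ihara for Shimura sets) — so the v5 datum is empty THERE; this is NOT a
refutation of the crux (no frame-level counterexample) and the executed pivot is the split by local
type with the semistable-pair re-cut on the abelian locus, not the Kato–Kurihara pivot; criterion
(1) stays armed for the remaining cells in the form «no semistable-pair / cuspidal-type datum
exists». UPDATE (tenure g7, promotion): the killable open inputs are now items — #8
LevelKolyvaginSystemsAdditive dies per local type (p, τ) by criterion (1) in the form «no definite
datum of type τ admits type-preserving BD-admissible level raising with multiplicity one» (realised
so far only for the Γ₀(p²)-anemic datum on (5, II*), which no line uses any more); #10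
BottomRankOneAdditive dies at ONE certified ♯ frame with Sel_p(E/K) ≅ ℤ/p and y_K ∈ pE(K) +
E(K)_tors (criterion (2) restricted to Ш[p] = 0 rows — such a frame would also refute BSD_p(E/K), so
either outcome is informative).

NOT DECOMPOSED YET. The crux IS decomposed by local type (rev 6). Still untyped as ITEMS (by design,
D-0019 two layers): the four mechanisms of the abelian bottom (S′ semistable level raising for
f_{E′}, A′ twisted rank-0 anchor, B′ first reciprocity with character, T′ twist transport) live as
stubs / crux idea on the abelian child (item 21398, was 20418; crux dir
Cruxes/KolyvaginPrimitiveAdditiveAbelianType/); the tree still has no inertial types, no finite-flat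
group schemes over tame extensions, no Selmer structure of the level-raised A_g with prescribed line
at q, and no Brandt module with nebentypus or cuspidal K-type (the e ∈ {3,4,6} and non-abelian
cells). The Manin constant is decomposed (rev 5: facts / proved off-exception and I*_n classes /
open residue); the E(K)[p] = 0 and tower-surjectivity steps stay inside the kernel support. HONEST
FRAMING on every booking (tribunal J, round 1): «BSD_p over K at a ♯ frame: unconditional (Kolyvagin
+ GZ + certificate); BSD_p(E/ℚ): conditional on the twist's rank-0 additive instance (residual
RankZeroAdditive)»; class rung — never summit credit. PROMOTION (tenure g7): KS and BOT are items
(#8, #10); their BY-TYPE halves (abelian: SubM ∨ SubGord — tame branch ∕ twisted Brandt bottom;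
non-abelian: SubTprime ∨ SubW — cuspidal-type Brandt module on the EGS-generic locus) are the stubs
of their `Lines/birth.lean` skeletons, not items (two layers kept); the E-side port is inside
support #9. Q-K4 RESOLVED → R-K4 APPLIED (director W-26, variant A, revs 19–20; see RANKED CRUXES):
the frame statements #2/#2a/#2b/#8/#10 carry «NumberField.discr K < -4 →»; nothing else of the texts
changed, no decomposition changed.

CHEAPEST FALSIFIER. Lookup + one kit job (first seat, not this cell): (i) lookup — is there a
printed Kolyvagin-conjecture theorem at p² ∣ N? (searched corpus + galaxy: none — see Novelty;
ceiling = p ∤ N / p ∥ N); (ii) J's RUNG-0/RUNG-1 table as ONE kit job over the smallest ♯ additive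
pairs (conductors 5²·q and 2·5²·q, p = 5, N > 5000 = outside the Miller 2011 / Miller–Stoll verified
range, r_an = 1, ρ̄ onto, ♠, 5 ∤ ∏c_q, a Hoffstein–Luo K): rows with 5 ∤ [E(K) : ℤ y_K]·(c∏c_q)⁻¹
are C-INSTANCES (c₁(1) = δ y_K ≠ 0 mod 5; book BSD_5(E/K) there unconditionally — Kolyvagin + GZ +
certificate), rows with M₀ ≥ 1 are the RUNG-1 candidates where the one-sided computation of KILL
CRITERIA (2) can refute the crux at a frame; attach the table as evidence on
stmt-BirchSwinnertonDyer-21400 (was 20132 before R-K4). The old falsifier (ii) «ord_p #Ш_an(E/K) vs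
ord_p index» is withdrawn — an identity by Gross–Zagier, not a test (J). (iii) NEW (crux idea
`twisted-brandt-bottom`, stub T′): for the smallest e = 2 ♯ frames (p ∈ {5,7}, v_p(N) = 2, E⊗χ_{p*}
semistable at p, r_an = 1, Heegner K with p split) compute v_p[E(K) : ℤ y_K] and v_p of the index of
the χ_K-twisted conductor-p Heegner point of E′ = E⊗χ_{p*} transported to E(K) (PARI: Heegner forms
of discriminant d_K and d_K p², modular parametrisations of E and E′, `lindep` on elliptic
logarithms); the lever predicts the two differ by ord_p of the explicit Cai–Shu–Tian Thm 1.1/1.5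
constant ratio — a frame where y_K is p-divisible while the twisted point is not kills T′ as a
one-directional stub (one kit_pari job, ≤ 30 core-min; this cell's planner seats have no kit). (iv)
for #7 ManinFrameResidueProper: ONE X₀(N)-optimal curve E₀ with p ≥ 5, p² ∣ N, Edixhoven-exception
type at p (p ≤ 7, or potentially good ordinary of type II/III/IV), no Iₙ* member, p ∣ deg φ₀ and p ∣
c₀ refutes the crux as typed (via p531398 `not_dvd_optimal_c_of_maninFrameResidueProper`);
Cremona/ARS give c₀ = 1 for every optimal curve of conductor < 5·10⁵ (48 942 ♯ residue keys there,
census d70ffdc336a9f529, all consistent), so the informative range is beyond the tables — the F2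
cell `bsd-f2-manin` (D-0131) owns that table; either outcome is informative (a hit kills #7 and
re-targets the road to the degree-free sub-locus already closed). MANIN-FREE FORM of the same test
at p ≥ 11 (TDS, p540328): exact modular degrees of ONE twist pair (E₀, E₀ ⊗ χ_{p*}) beyond Cremona's
range — E₀ unstarred pot-ordinary II/III/IV, p ≥ 13, p ∣ deg φ₀, N = p²N′ > 5·10⁵: deg♭/deg = p
confirms TDS there, 1/p refutes TDS, #7 and Manin at once (F2 / kit seat). (v) for #8 KS — LOOKUP
DONE (tenure g7, MEMO-anchor-v1): every refereed rank-0 anchor in the Skinner–Urban direction has p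
∤ N (SU 2014 Thm 1/3, Kim–Ota, Wan, CLW, BSTW) or p ∥ N (Skinner 2016, Skinner–Zhang); at p² ∣ N
only the Fouquet–Wan preprint Cor 1.10/5.4 (ρ̄ abs. irreducible, (Lgl)_p, a ρ̄-ramified Steinberg
prime, NON-SPLIT when ρ̄|G_p is irreducible); so the crux chain's first triage question on #8 is
binary and cheap: does FW + (Lgl)_p cover the pot-ordinary ABELIAN type given the frame's ♠ primes
(then KS-AB's anchor is «in preprint», to be typed as an _OPEN fact), and is there ANY claim for
ρ̄|G_p irreducible types without a non-split Steinberg prime (memo: none found in corpus + galaxy).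

NUMBERS. WALL-TABLE row 2 (H0 window N ≤ 30 000, p odd additive, r_an ≤ 1): 7 767 rank-one keys of 7
816 additive keys in the r1 window are open in
print; X4♯ (G-ord, e = 2) ∩ r1: 576 at p = 3, 128 at p ≥ 5 (35 + 13 non-surjective). Raynaud bound e
< p − 1 fails only for (p, e) ∈
{(5,4), (5,6), (7,6)}. Zhang's standing hypotheses: p ≥ 5, ρ̄ onto, ♠, p ∤ N (WZhang2014 Thm 1.1);
Sweeting: p ∤ N·D_K, p ≥ 5, ♠, big image.

DEFINITION REQUESTS. None at open (all constants exist: Addv, BSDp, KolyvaginHeegnerData,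
KolyvaginDescent.KolSupp, Zhang2014.IsKolyvaginPrime,
ModularParametrizationData, HeegnerDatum, heegnerPointComplex, WeierstrassCurve.selmerGroup).
Foreseen (layer 2): inertial Weil–Deligne type
at p of a weight-2 newform; the finite-flat line of E[p] over the tame splitting field. FILED
(tenure g3) AND LANDED 2026-08-27: defn-CuspidalTypeBrandtModule
(Literature/NumberTheory/EllipticCurves/CuspidalTypeBrandtModule.lean +
Automorphic/BrandtCuspidalTypeForms.lean) — the cuspidal-K-type isotypic Brandt module at p for the
non-abelian child.

Novelty: Searches (2026-08-27): `lit search --hybrid "Kolyvagin conjecture additive reduction level raising"`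
(0 relevant; hits = Zhang 2014, Sweeting,
BCGS arXiv:1909.07835 all p ∤ N); `lit vsearch "non-vanishing of Kolyvagin system of Heegner points
at a prime of additive reduction"` (top:
arXiv:2012.11771 p. 3 «p ∤ N D_K», Zhang 2014 p. 41); `lit galaxy search "Kolyvagin
conjecture|indivisibility of Heegner" --star all` (Zhang,
Sweeting, Gross; no additive); `lit galaxy search "level raising|prescribed type" --star pdf` (Gee,
Kisin; no BSD use); `lit frontier
BirchSwinnertonDyer --since 2020`, `lit bridges BirchSwinnertonDyer --cross any` (no
level-raising-at-additive-p item); OpenAlex/S2 rate-limited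
(HTTP 429) — corpus + galaxy + zbMATH only; tree: `lean search 'kolyvaginClass'` (all consumers at p
= 3 multiplicative or p ∤ N);
152 summit cards and the 6 additive routes read: none uses level raising.
Nearest prior art found: arXiv:2410.23241 (Keller–Yin 2024, p. 4: «we extend the Kolyvagin system
argument to some new cases in the additive reduction setting» — VERTICAL: Heegner-point Kolyvagin
systems + anticyclotomic main conjectures at potentially good ORDINARY additive p, Eisenstein case,
p-converse only; potentially multiplicative / supersingular excluded «due to the lack of tools»)
[corpus: paper:arxiv-2410.23241 p4 L16–30]; arXiv:1808.07726 (Kato Euler systems at additive p > 7,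
Kurihara side) [corpus: paper:arxiv-1808.07726 p4]; WZhang2014 (Camb. J. Math. 2, Thm 1.1: p ∤ N  [refs: 1909.07835, 2012.11771, 2410.23241, 1808.07726, 1407.1099, paper:arxiv-2410.23241, paper:arxiv-1808.07726, paper:doi-10-4310-cjm-2014-v2-n2-a2, paper:arxiv-2012.11771, WZhang2014, Sweeting2020, SkinnerZhang2014]

Barriers (technique_class: heegner-points kolyvagin-systems level-raising): - technique_class: heegner-points kolyvagin-systems level-raising
- Literature.Barriers.BirchSwinnertonDyer.HeegnerPointBarrier: outside — every item carries
`W.analyticRank = 1` (or ≤ 1) and the kernel works over a Hoffstein–Luo K with L(E^(d_K),1) ≠ 0, so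
ord_{s=1} L(E/K,s) = 1 and y_K is non-torsion; the barrier quantifies over 2 ≤ r_an only.
- Literature.Barriers.BirchSwinnertonDyer.HeegnerPointBarrierNarrow: outside for the same reason
(r_an(E/K) = 1, the bottom class c(1) = δ y_K is a point of infinite order); the crux is the mod-p
non-vanishing of c(1), not a point supply in rank ≥ 2.
- Literature.Barriers.BirchSwinnertonDyer.SelmerRankBarrier: outside — Ш(E/K)[p^∞] is finite by
Kolyvagin's theorem (named fact `kolyvagin`) at r_an(E/K) = 1, and the crux gives the exact order
via McCallum's structure theorem, not a corank bound.
- Literature.Barriers.BirchSwinnertonDyer.SelmerRankBarrierNarrow: outside (same: rank ≤ 1 over K,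
Selmer corank realised by the Heegner point).
- Literature.Barriers.BirchSwinnertonDyer.ReducibleAnticyclotomicAtBadP: outside its hypothesis (ρ̄
onto in the crux; Eisenstein additive rows sit in the residual OffSharpRankOneAdditive) — but the
same KIND of scope wall for p ∣ N is met head-on: every printed Kolyvagin-conjecture theorem has p ∤
N or p ∥ N; it does not evade it; the bet is that p ∤ N is used only at Zhang's three named places
(local condition at p, DT level raising / Ihara, SU anchor) and each has an additive substitute.
- Literature.

History (route lifecycle, newest last):
- 2026-08-27T10:15:56Z · rev 9: informal re-worded for ManinFrameResidueClass (planner-bsd-wall-add-g3-0)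
- 2026-08-27T16:18:49Z · AUTO-CRUX (edit): ManinFrameResidueProperR — hypotheses of the deciding theorem that nothing in the route derives are cruxes (planner-bsd-wall-add-g6-0)
- 2026-08-27T17:54:05Z · rev 18: restated PublishedDualityInputsAdditiveKoly (stmt-BirchSwinnertonDyer-21267) — tenure g7: restate PublishedDualityInputsAdditiveKoly — Cassels–Tate conjunct → LEVELWISE inputs `casselsTate_levelInputs K` (explicit binder; the p = 3 road's (planner-bsd-wall-add-g7-0)
- 2026-08-27T17:54:55Z · rev 18: restated PublishedDualityInputsAdditiveKoly (stmt-BirchSwinnertonDyer-21267) — tenure g7: restate PublishedDualityInputsAdditiveKoly — Cassels–Tate conjunct → LEVELWISE inputs `casselsTate_levelInputs K` (explicit binder; the p = 3 road's (planner-bsd-wall-add-g7-0)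
- 2026-08-27T19:01:50Z · rev 20: restated LevelKolyvaginSystemsAdditive (stmt-BirchSwinnertonDyer-21264), BottomRankOneAdditive (stmt-BirchSwinnertonDyer-21265), KolyvaginPrimitiveAdditiveAbelianType (stmt-BirchSwinnertonDyer-20418), KolyvaginPrimitiveAdditiveNonAbelianType (stmt-BirchSwinnertonDyer-20419), KolyvaginPrimitiveAdditive (stmt-Bir (planner-bsd-wall-add-g7-0)

sub-problem: BirchSwinnertonDyer · status: open · opened planner-bsd-wall-add-g0-0 2026-08-27T04:25:22Z · rev 23 · ledger route-BirchSwinnertonDyer-AdditiveKolyvaginRoad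
GENERATED by the gate from the ledger (D-0016/17). Provers cite these decls: `theorem foo : Summit.BirchSwinnertonDyer.BirchSwinnertonDyer.Theses.AdditiveKolyvaginRoad.<Decl> := …` in Summits/BirchSwinnertonDyer/BirchSwinnertonDyer/Theorems/<Name>.lean.
-/

namespace Summit.BirchSwinnertonDyer.BirchSwinnertonDyer.Theses.AdditiveKolyvaginRoad

open scoped BigOperators Topology Manifold Classical MeasureTheory ProbabilityTheory Matrix InnerProductSpace ComplexConjugate ContinuousMap
open Filter Set Function TopologicalSpace MeasureTheory

attribute [summit_statement] _root_.BirchSwinnertonDyer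
attribute [summit_statement] _root_.Summit.BirchSwinnertonDyer.WAllExclAdditive

open Literature

/-! Retired items kept as plain definitions (history; not obligations of this route): landed proofs / closed glue still name them. -/

/-- retired stmt-BirchSwinnertonDyer-19383 (moot, gen 2) — named by an active item. -/
def MazurManinConstantOddPrimes : Prop :=
  Literature.NumberTheory.EllipticCurves.ModularForms.mazur_not_dvd_maninConstant_of_odd

/-- retired stmt-BirchSwinnertonDyer-20089 (moot, gen 2) — named by an active item. -/
def EdixhovenManinKodairaType : Prop :=
  Literature.NumberTheory.EllipticCurves.ModularForms.edixhoven_not_dvd_maninConstant_of_kodairaSymbol_ne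

/-- retired stmt-BirchSwinnertonDyer-20090 (moot, gen 2) — named by an active item. -/
def AbbesUllmoManinConstantGoodPrimes : Prop :=
  Literature.NumberTheory.EllipticCurves.ModularForms.abbesUllmo_not_dvd_maninConstant_of_not_dvd_level

/-- retired stmt-BirchSwinnertonDyer-20091 (moot, gen 2) — named by an active item. -/
def CesnaviciusManinConstantAtTwo : Prop :=
  Literature.NumberTheory.EllipticCurves.ModularForms.cesnavicius_not_two_dvd_maninConstant_of_two_dvd_level

/-- retired stmt-BirchSwinnertonDyer-20323 (moot, gen 2) — named by an active item. -/
def EdixhovenManinNonPotOrdinary : Prop :=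
  Literature.NumberTheory.EllipticCurves.ModularForms.edixhoven_not_dvd_maninConstant_of_not_potentiallyGoodOrdinary

-- earlier KolyvaginPrimitiveAdditive (stmt-BirchSwinnertonDyer-20132, replaced 2026-08-27T19:01:50Z -> stmt-BirchSwinnertonDyer-21400): retired by None — ∀ (W : WeierstrassCurve ℚ) [W.IsElliptic] [W.IsGloballyMinimal] [NeZero (W.conductorNorm ℤ)] (p : ℕ) [Fact p.Prime] (K : Type) [Field K] [NumberField K] (Dt : Literature.NumberTheory.EllipticCurves.ModularForms.ModularParametrizationData W (W.condu
/-- item stmt-BirchSwinnertonDyer-21400 · crux · rank 2 · open · by planner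
why it might fail: the rank-0 anchor for level-raised forms of additive type at p is Skinner–Urban territory at infinite slope (open); type-preserving level raising may miss BD-admissibility; Kummer lines of congruent A_g may differ at (p,e) ∈ {(5,4),(5,6),(7,6)}.
sources: WZhang2014, arXiv:0810.1877, arXiv:1907.06043, arXiv:2107.13726, Kato2004, Sweeting2020
retired/moot children: KolyvaginPrimitiveAdditiveAbelianType [replaced: ∀ (W : WeierstrassCurve ℚ) [W.IsElliptic] [W.IsGloballyMinimal] [NeZero (W.condu]; KolyvaginPrimitiveAdditiveNonAbelianType [replaced: ∀ (W : WeierstrassCurve ℚ) [W.IsElliptic] [W.IsGloballyMinimal] [NeZero (W.condu]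
[crux] Kolyvagin's conjecture mod p at an additive prime p ≥ 5 in the ∀-Manin-good-frame ♯ typing of
the p = 3 kernel: for every frame (W, p, K, Dt, β, ι) with 5 ≤ p, Addv W p, ρ̄ onto, ♠(1), ♠(2), p ∤
∏c, r_an = 1, K imaginary quadratic with odd d_K, Heegner hypothesis, L(E^(d_K),1) ≠ 0, 4N ∣ β² −
d_K, p ∤ c_Manin(Dt): some Kolyvagin–Heegner datum of Kolyvagin-prime support has c(1) ≠ 0 in H¹(K,
E[p]). [difficulty: open-problem] -/
@[route_item "route-BirchSwinnertonDyer-AdditiveKolyvaginRoad", crux]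
def KolyvaginPrimitiveAdditive : Prop :=
  ∀ (W : WeierstrassCurve ℚ) [W.IsElliptic] [W.IsGloballyMinimal] [NeZero (W.conductorNorm ℤ)] (p : ℕ) [Fact p.Prime] (K : Type) [Field K] [NumberField K] (Dt : Literature.NumberTheory.EllipticCurves.ModularForms.ModularParametrizationData W (W.conductorNorm ℤ)) (β : ℤ) (ι : K →+* ℂ), 5 ≤ p → Literature.NumberTheory.EllipticCurves.Rank1Residual.Addv W p → W.HasSurjectiveModNGaloisRep p → (∀ (ℓ : ℕ) [Fact ℓ.Prime], W.HasMultiplicativeReductionAtPrime ℓ → ¬ p ∣ padicValInt ℓ W.minimalDiscriminantInt) → (∃ (ℓ₁ ℓ₂ : ℕ) (_ : Fact ℓ₁.Prime) (_ : Fact ℓ₂.Prime), ℓ₁ ≠ ℓ₂ ∧ W.HasMultiplicativeReductionAtPrime ℓ₁ ∧ W.HasMultiplicativeReductionAtPrime ℓ₂) → ¬ p ∣ W.tamagawaProduct → W.analyticRank = 1 → Literature.NumberTheory.EllipticCurves.IsImaginaryQuadratic K → Odd (NumberField.discr K) → NumberField.discr K < -4 → Literature.NumberTheory.EllipticCurves.SatisfiesHeegnerHypothesis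 (W.conductorNorm ℤ) K → (W.quadraticTwist (NumberField.discr K : ℚ)).entireLFunction 1 ≠ 0 → (4 * (W.conductorNorm ℤ : ℤ)) ∣ β ^ 2 - NumberField.discr K → ¬ (p : ℤ) ∣ Dt.c → ∃ (n : ℕ) (d : Literature.NumberTheory.EllipticCurves.KolyvaginHeegnerData Dt β ι n), Literature.NumberTheory.EllipticCurves.KolyvaginDescent.KolSupp (Literature.NumberTheory.EllipticCurves.Zhang2014.IsKolyvaginPrime (W.conductorNorm ℤ) W K p) n ∧ d.kolyvaginClass (Fact.out : p.Prime) 1 ≠ 0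

-- parent: KolyvaginPrimitiveAdditive · child (gen 1)
/--     item stmt-BirchSwinnertonDyer-21398 · crux · rank 201 · open
    parent: KolyvaginPrimitiveAdditive · by planner
    why it might fail: rank-0 anchor needs the ε̄-(tame-)branch IMC for g_ε/K in the Skinner–Urban direction, unprinted off defect 2 (tree: TameBranchRatCharEq); conductor-p toric period for e > 2 needs a test-vector statement; BD-admissible q must avoid p and the type.
    sources: WZhang2014, arXiv:0810.1877, arXiv:1907.06043, Delbourgo1998, SkinnerZhang2014, arXiv:2107.13726
[crux] child A of KolyvaginPrimitiveAdditive by LOCAL TYPE at p: the parent verbatim restricted to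
additive p ≥ 5 of ABELIAN tame type (`SubM W p ∨ SubGord W p`: potentially multiplicative, or
potentially good with e = semistabilityIndex ∣ p − 1) — the locus (all 119 counted ♯ keys: (M) 71 +
X4 G-ord e=2 48, plus G-ord e ∈ {3,4,6}) where the definite level-raised datum re-types on the TAME
BRANCH g_ε = f_E ⊗ ε̄ (level K₀(p)·M, nebentypus ε̄², 𝔭-ordinary; toric period twisted by
(ε∘N_{K/ℚ})⁻¹ over CM points of conductor p), so that multiplicity one is Zhang 2014 (4.8) for E′ =
E ⊗ χ_{p*} (e = 2) resp. a standard ordinary-with-nebentypus TW statement (e ∈ {3,4,6}) instead of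
the unfounded Γ₀(p²)-anemic `multOne` (memo-multOne-v1.md §§3–5). [difficulty: open-problem] -/
@[route_item "route-BirchSwinnertonDyer-AdditiveKolyvaginRoad", crux]
def KolyvaginPrimitiveAdditiveAbelianType : Prop :=
  ∀ (W : WeierstrassCurve ℚ) [W.IsElliptic] [W.IsGloballyMinimal] [NeZero (W.conductorNorm ℤ)] (p : ℕ) [Fact p.Prime] (K : Type) [Field K] [NumberField K] (Dt : Literature.NumberTheory.EllipticCurves.ModularForms.ModularParametrizationData W (W.conductorNorm ℤ)) (β : ℤ) (ι : K →+* ℂ), 5 ≤ p → Literature.NumberTheory.EllipticCurves.Rank1Residual.Addv W p → (Summit.BirchSwinnertonDyer.Rank1Residual.Additive.SubM W p ∨ Summit.BirchSwinnertonDyer.Rank1Residual.Additive.SubGord W p) → W.HasSurjectiveModNGaloisRep p → (∀ (ℓ : ℕ) [Fact ℓ.Prime], W.HasMultiplicativeReductionAtPrime ℓ → ¬ p ∣ padicValInt ℓ W.minimalDiscriminantInt) → (∃ (ℓ₁ ℓ₂ : ℕ) (_ : Fact ℓ₁.Prime) (_ : Fact ℓ₂.Prime), ℓ₁ ≠ ℓ₂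 ∧ W.HasMultiplicativeReductionAtPrime ℓ₁ ∧ W.HasMultiplicativeReductionAtPrime ℓ₂) → ¬ p ∣ W.tamagawaProduct → W.analyticRank = 1 → Literature.NumberTheory.EllipticCurves.IsImaginaryQuadratic K → Odd (NumberField.discr K) → NumberField.discr K < -4 → Literature.NumberTheory.EllipticCurves.SatisfiesHeegnerHypothesis (W.conductorNorm ℤ) K → (W.quadraticTwist (NumberField.discr K : ℚ)).entireLFunction 1 ≠ 0 → (4 * (W.conductorNorm ℤ : ℤ)) ∣ β ^ 2 - NumberField.discr K → ¬ (p : ℤ) ∣ Dt.c → ∃ (n : ℕ) (d : Literature.NumberTheory.EllipticCurves.KolyvaginHeegnerData Dt β ι n), Literature.NumberTheory.EllipticCurves.KolyvaginDescent.KolSupp (Literature.NumberTheory.EllipticCurves.Zhang2014.IsKolyvaginPrime (W.conductorNorm ℤ) W K p) n ∧ d.kolyvaginClass (Fact.out : p.Prime) 1 ≠ 0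

-- parent: KolyvaginPrimitiveAdditive · child (gen 1)
/--     item stmt-BirchSwinnertonDyer-21399 · crux · rank 202 · open
    parent: KolyvaginPrimitiveAdditive · by planner
    why it might fail: at (5, Kodaira II*) ρ̄_{E,5} is finite flat, so every level-p² anemic eigenspace contains ≥ 3 p-old lines (landed datum empty ∀ q); a supercuspidal-type anchor (IMC at a pot-supersingular additive p) has no printed lower bound at all.
    sources: Serre1972, arXiv:1305.1594, arXiv:0810.1877, arXiv:1907.06043, WZhang2014
[crux] child B of KolyvaginPrimitiveAdditive by LOCAL TYPE at p: the parent verbatim restricted to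
additive p ≥ 5 of NON-ABELIAN type (`SubTprime W p ∨ SubW W p`: potentially good with e ∤ p − 1,
i.e. supercuspidal local type, pot-supersingular over the tame field; SubW is vacuous for p ≥ 5). No
Dirichlet untwist exists; the definite side needs a cuspidal K-type Brandt module
Hom_{GL₂(ℤ_p)}(Θ(θ), S(U^p)) (definition item first); the Γ₀(p²)-anemic multiplicity one of the
landed `DefiniteLevelRaisedDatum` is FALSE on the whole Kodaira II* cell at p = 5, where ρ̄_{E,5} is
finite flat (p-old lines of a 5-good congruent newform; memo-multOne-v1.md §3) and unfounded
elsewhere on this cell. Census: 'pot-supersingular p ≥ 5: count owed' (census_sharp.md).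
[difficulty: open-problem] -/
@[route_item "route-BirchSwinnertonDyer-AdditiveKolyvaginRoad", crux]
def KolyvaginPrimitiveAdditiveNonAbelianType : Prop :=
  ∀ (W : WeierstrassCurve ℚ) [W.IsElliptic] [W.IsGloballyMinimal] [NeZero (W.conductorNorm ℤ)] (p : ℕ) [Fact p.Prime] (K : Type) [Field K] [NumberField K] (Dt : Literature.NumberTheory.EllipticCurves.ModularForms.ModularParametrizationData W (W.conductorNorm ℤ)) (β : ℤ) (ι : K →+* ℂ), 5 ≤ p → Literature.NumberTheory.EllipticCurves.Rank1Residual.Addv W p → (Summit.BirchSwinnertonDyer.Rank1Residual.Additive.SubTprime W p ∨ Summit.BirchSwinnertonDyer.Rank1Residual.Additive.SubW W p) → W.HasSurjectiveModNGaloisRep p → (∀ (ℓ : ℕ) [Fact ℓ.Prime], W.HasMultiplicativeReductionAtPrime ℓ → ¬ p ∣ padicValInt ℓ W.minimalDiscriminantInt) → (∃ (ℓ₁ ℓ₂ : ℕ) (_ : Fact ℓ₁.Prime) (_ : Fact ℓ₂.Prime), ℓ₁ ≠ ℓ₂ ∧ W.HasMultiplicativeReductionAtPrime ℓ₁ ∧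 W.HasMultiplicativeReductionAtPrime ℓ₂) → ¬ p ∣ W.tamagawaProduct → W.analyticRank = 1 → Literature.NumberTheory.EllipticCurves.IsImaginaryQuadratic K → Odd (NumberField.discr K) → NumberField.discr K < -4 → Literature.NumberTheory.EllipticCurves.SatisfiesHeegnerHypothesis (W.conductorNorm ℤ) K → (W.quadraticTwist (NumberField.discr K : ℚ)).entireLFunction 1 ≠ 0 → (4 * (W.conductorNorm ℤ : ℤ)) ∣ β ^ 2 - NumberField.discr K → ¬ (p : ℤ) ∣ Dt.c → ∃ (n : ℕ) (d : Literature.NumberTheory.EllipticCurves.KolyvaginHeegnerData Dt β ι n), Literature.NumberTheory.EllipticCurves.KolyvaginDescent.KolSupp (Literature.NumberTheory.EllipticCurves.Zhang2014.IsKolyvaginPrime (W.conductorNorm ℤ) W K p) n ∧ d.kolyvaginClass (Fact.out : p.Prime) 1 ≠ 0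

-- parent: KolyvaginPrimitiveAdditive · glue (gen 1)
/--     item stmt-BirchSwinnertonDyer-20420 · support · rank 203 · closed · proved by Summit.BirchSwinnertonDyer.BirchSwinnertonDyer.Theorems.AdditiveKoly.kolyvaginPrimitiveAdditiveGlue (prover)
    parent: KolyvaginPrimitiveAdditive · GLUE: children ⟹ parent · by planner
KolyvaginPrimitiveAdditiveAbelianType → KolyvaginPrimitiveAdditiveNonAbelianType →
KolyvaginPrimitiveAdditive — by Rank1Residual.Additive.sub_exhaustive (SubM ∨ SubGord ∨ SubTprime ∨
SubW), 6-line proof in SplitByType.lean `kolyvaginPrimitiveAdditive_of_types` (rc 0) -/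
@[route_item "route-BirchSwinnertonDyer-AdditiveKolyvaginRoad"]
def KolyvaginPrimitiveAdditiveGlue : Prop :=
  KolyvaginPrimitiveAdditiveAbelianType → KolyvaginPrimitiveAdditiveNonAbelianType → KolyvaginPrimitiveAdditive

-- `KolyvaginPrimitiveAdditiveGlue` holds: proved by `Summit.BirchSwinnertonDyer.BirchSwinnertonDyer.Theorems.AdditiveKoly.kolyvaginPrimitiveAdditiveGlue` (its module imports this route file, so no `_holds` link can be stated here).

/-- item stmt-BirchSwinnertonDyer-20133 · crux · rank 3 · open · by planner
why it might fail: it cannot fail as mathematics short of ¬BSD; as a WORK ITEM it is the whole rank-0 additive lower half (Kato gives only ≤; equality at pot. supersingular e ∈ {3,4,6} and at pot. multiplicative p has no printed proof).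
sources: Kato2004, Delbourgo1998, Delbourgo2002, arXiv:2505.09121, arXiv:2107.13726
[crux] RESIDUAL (imported complement, attacked by the sibling routes AdditiveBranchIMC /
QuadraticBranchSignedControl / KatoDescentTamePotSupersingular / KatoDescentPotSupersingular): BSD_p
for every non-CM E/ℚ of analytic rank 0 at every additive prime p ≥ 5. It is also consumed INSIDE
the kernel (the twist E^(d_K) has rank 0 and the same additive type at p). [difficulty:
open-problem] -/
@[route_item "route-BirchSwinnertonDyer-AdditiveKolyvaginRoad", crux]
def RankZeroAdditive : Prop :=
  ∀ (W : WeierstrassCurve ℚ) [W.IsElliptic] [W.IsGloballyMinimal] (p : ℕ) [Fact p.Prime], ¬ W.HasCM → 5 ≤ p → Literature.NumberTheory.EllipticCurves.Rank1Residual.Addv W p → W.analyticRank = 0 → Literature.NumberTheory.EllipticCurves.BSDp W p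

/-- item stmt-BirchSwinnertonDyer-20134 · crux · rank 4 · open · by planner
why it might fail: as a work item it contains the Eisenstein additive rank-one rows (ρ̄ reducible, p ≥ 5: p = 5, 7 only by Mazur) and the p ∣ c_ℓ rows where Kolyvagin's c(1) DOES vanish mod p (Jetchev2008), so the road itself cannot serve it.
sources: Jetchev2008, WZhang2014, GrossZagier1986, Kolyvagin1991
[crux] RESIDUAL: BSD_p for the non-CM rank-one additive rows at p ≥ 5 OFF the ♯ locus (ρ̄_(E,p) not
onto, or ♠ fails, or p ∣ ∏ c_ℓ) — the rows no Heegner-point Kolyvagin argument in print reaches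
(Jetchev: p ∣ c_ℓ forces extra divisibility of y_K). [difficulty: open-problem] -/
@[route_item "route-BirchSwinnertonDyer-AdditiveKolyvaginRoad", crux]
def OffSharpRankOneAdditive : Prop :=
  ∀ (W : WeierstrassCurve ℚ) [W.IsElliptic] [W.IsGloballyMinimal] (p : ℕ) [Fact p.Prime], ¬ W.HasCM → 5 ≤ p → Literature.NumberTheory.EllipticCurves.Rank1Residual.Addv W p → W.analyticRank = 1 → ¬ (W.HasSurjectiveModNGaloisRep p ∧ (∀ (ℓ : ℕ) [Fact ℓ.Prime], W.HasMultiplicativeReductionAtPrime ℓ → ¬ p ∣ padicValInt ℓ W.minimalDiscriminantInt) ∧ (∃ (ℓ₁ ℓ₂ : ℕ) (_ : Fact ℓ₁.Prime) (_ : Fact ℓ₂.Prime), ℓ₁ ≠ ℓ₂ ∧ W.HasMultiplicativeReductionAtPrime ℓ₁ ∧ W.HasMultiplicativeReductionAtPrime ℓ₂) ∧ ¬ p ∣ W.tamagawaProduct) → Literature.NumberTheory.EllipticCurves.BSDp W p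

/-- item stmt-BirchSwinnertonDyer-20135 · crux · rank 5 · open · by planner
why it might fail: as a work item: wild ramification at 3 (conductor exponent up to 5), no finite-flat models over a tame field, ρ̄_(E,3) onto does not propagate to 3-power level; no printed BSD_3 formula in rank 1 at additive 3.
sources: arXiv:2505.09121, Kato2004, Delbourgo1998, WZhang2014
[crux] RESIDUAL: BSD_3 for every non-CM E/ℚ of analytic rank ≤ 1 with additive reduction at 3 (wild
e ∈ {6,12,…} and tame) — the territory of KimAtThreeKolyvagin / KatoDescentPotSupersingular /
AdditiveBranchIMC; excluded from the road because Zhang's hypotheses need p ≥ 5 (tower surjectivity,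
Lemma 5.3). [difficulty: open-problem] -/
@[route_item "route-BirchSwinnertonDyer-AdditiveKolyvaginRoad", crux]
def AdditiveAtThree : Prop :=
  ∀ (W : WeierstrassCurve ℚ) [W.IsElliptic] [W.IsGloballyMinimal], ¬ W.HasCM → Literature.NumberTheory.EllipticCurves.Rank1Residual.Addv W 3 → W.analyticRank ≤ 1 → Literature.NumberTheory.EllipticCurves.BSDp W 3

-- earlier LevelKolyvaginSystemsAdditive (stmt-BirchSwinnertonDyer-21264, replaced 2026-08-27T19:01:50Z -> stmt-BirchSwinnertonDyer-21396): retired by None — ∀ (W : WeierstrassCurve ℚ) [W.IsElliptic] [W.IsGloballyMinimal] [NeZero (W.conductorNorm ℤ)] (p : ℕ) [Fact p.Prime] (K : Type) [Field K] [NumberField K] (Dt : Literature.NumberTheory.EllipticCurves.ModularForms.ModularParametrizationData W (W.co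
/-- item stmt-BirchSwinnertonDyer-21396 · crux · rank 8 · open · by planner
why it might fail: Rank-0 anchor for level-raised forms of additive type at p is unproved: refereed print has p ∤ N (SU 2014) or p ∥ N (Skinner 2016); at p² ∣ N only the Fouquet–Wan preprint, only on its non-split-Steinberg/(Lgl) locus; multiplicity one at p²-level fails off the EGS-generic locus ((5, II*)).
sources: WZhang2014, doi:10.1007/s00222-013-0448-1, arXiv:2107.13726, arXiv:0810.1877, arXiv:1907.06043, arXiv:1305.1594
[crux] KS — PROMOTED STUB (lead akr-p1 g3 handback `promote-stub`, line `birth` v8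
`stub_levelKolyvaginSystemsAdditive`, verbatim): W. Zhang's LEVEL KOLYVAGIN SYSTEMS exist at every ♯
additive frame (p ≥ 5, Addv, ρ̄ onto, ♠(1)(2), p ∤ ∏c, r_an = 1, odd Heegner K, 4N ∣ β² − d_K, p ∤
c_Manin): for complex conjugation c ≠ 1, `Nonempty (LevelKolyvaginSystemP W K p Dt β ι c)` — classes
κ m n ∈ H¹(K, E[p]) at every finite BD-admissible level n and Kolyvagin conductor m, realising the
frame's Kolyvagin classes at n = ∅, with the Kolyvagin-system axioms at non-empty levels (sign,
Kummer off m ∪ n, toric on n, transverse on m, (8.1)), (A2) TRANSPORT = Zhang Thm 4.3 (BD05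
reciprocity laws + Ihara ∕ multiplicity one at p²-level, type-preserving level raising) and (A5)
BASE CASE = Zhang Thm 7.2 at non-empty even levels (rank-0 anchor for the level-raised forms g_n OF
THE SAME ADDITIVE TYPE at p + first reciprocity law). THE OPEN MATHEMATICS of crux r2 above the
bottom; in print only for p ∤ N (Zhang 2014 §7.1 p.231: ordinariness enters only through Thm 7.1 =
Skinner–Urban; SU 2014 Thm 1/3 need trivial character and p ∤ N; DT94 level raising and Helm/PW
multiplicity one need p ∤ N). At p² ∣ N: -/
@[route_item "route-BirchSwinnertonDyer-AdditiveKolyvaginRoad", crux]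
def LevelKolyvaginSystemsAdditive : Prop :=
  ∀ (W : WeierstrassCurve ℚ) [W.IsElliptic] [W.IsGloballyMinimal] [NeZero (W.conductorNorm ℤ)] (p : ℕ) [Fact p.Prime] (K : Type) [Field K] [NumberField K] (Dt : Literature.NumberTheory.EllipticCurves.ModularForms.ModularParametrizationData W (W.conductorNorm ℤ)) (β : ℤ) (ι : K →+* ℂ), 5 ≤ p → Literature.NumberTheory.EllipticCurves.Rank1Residual.Addv W p → W.HasSurjectiveModNGaloisRep p → (∀ (ℓ : ℕ) [Fact ℓ.Prime], W.HasMultiplicativeReductionAtPrime ℓ → ¬ p ∣ padicValInt ℓ W.minimalDiscriminantInt) → (∃ (ℓ₁ ℓ₂ : ℕ) (_ : Fact ℓ₁.Prime) (_ : Fact ℓ₂.Prime), ℓ₁ ≠ ℓ₂ ∧ W.HasMultiplicativeReductionAtPrime ℓ₁ ∧ W.HasMultiplicativeReductionAtPrime ℓ₂) → ¬ p ∣ W.tamagawaProduct → W.analyticRank = 1 → Literature.NumberTheory.EllipticCurves.IsImaginaryQuadratic K → Odd (NumberField.discr K) → NumberField.discr K < -4 → Literature.NumberTheory.EllipticCurves.SatisfiesHeegnerHypothesis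 (W.conductorNorm ℤ) K → (W.quadraticTwist (NumberField.discr K : ℚ)).entireLFunction 1 ≠ 0 → (4 * (W.conductorNorm ℤ : ℤ)) ∣ β ^ 2 - NumberField.discr K → ¬ (p : ℤ) ∣ Dt.c → ∀ (c : K ≃ₐ[ℚ] K), c ≠ 1 → ∀ [Module (ZMod p) (Summit.BirchSwinnertonDyer.BirchSwinnertonDyer.Theorems.AdditiveKoly.Vp W K p)], Nonempty (Summit.BirchSwinnertonDyer.BirchSwinnertonDyer.Theorems.AdditiveKoly.LevelKolyvaginSystemP W K p Dt β ι c)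

/-- item stmt-BirchSwinnertonDyer-20137 · support · rank 9 · SPLIT (gen 1) into RankEqAnalyticRankLeOne, EntireLFunctionRat, NewformOfEllipticCurve, HoffsteinLuoNonvanishingTwist, McCallumShaStructureCertificate, ParametrisedInputsAdditiveKoly + glue PublishedInputsAdditiveKolyGlue · direct attempts still welcome (low priority) · by planner
sources: GrossZagier1986, Kolyvagin1991, McCallumLMS1991, HoffsteinLuo1997, Darmon2004
[support] the conjunction of the tree's NAMED published facts the kernel consumes (Gross–Zagier,
Kolyvagin, Kolyvagin's Ш-bound, GZK rank over ℚ, modularity, newforms, Hoffstein–Luo,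
Galois-conjugation of the conductor-1 Heegner point, McCallum's structure theorem, Darmon Thm 3.6) —
hypotheses, never asserted. [difficulty: provable-now] -/
@[route_item "route-BirchSwinnertonDyer-AdditiveKolyvaginRoad", crux]
def PublishedInputsAdditiveKoly : Prop :=
  (∀ (N : ℕ) [NeZero N] (W : WeierstrassCurve ℚ) (K : Type) [Field K] [NumberField K], Literature.NumberTheory.EllipticCurves.gross_zagier N W K) ∧ (∀ (N : ℕ) [NeZero N] (W : WeierstrassCurve ℚ) (K : Type) [Field K] [NumberField K], Literature.NumberTheory.EllipticCurves.kolyvagin N W K) ∧ (∀ (N : ℕ) [NeZero N] (W : WeierstrassCurve ℚ) (K : Type) [Field K] [NumberField K], Literature.NumberTheory.EllipticCurves.Kolyvagin1990_padicValNat_card_sha_le N W K) ∧ Literature.NumberTheory.EllipticCurves.rank_eq_analyticRank_of_analyticRank_le_one ∧ WeierstrassCurve.hasEntireLFunction_rat ∧ Literature.NumberTheory.EllipticCurves.ModularForms.exists_isNewformOf ∧ Literature.NumberTheory.EllipticCurves.HoffsteinLuo1997_exists_twist_L_one_ne_zero ∧ (∀ (N : ℕ) [NeZero N] (W : WeierstrassCurve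 ℚ) (K : Type) [Field K] [NumberField K], Literature.NumberTheory.EllipticCurves.heegnerPointOfConductor_one_galoisConj N W K) ∧ Literature.NumberTheory.EllipticCurves.McCallum1991_pow_dvd_card_sha_primary_of_certificate ∧ (∀ (N : ℕ) [NeZero N] (W : WeierstrassCurve ℚ) (K : Type) [Field K] [NumberField K], Literature.NumberTheory.EllipticCurves.phi_heegnerTau_mem_range_map_singularModuliField N W K)

/-- retired stmt-BirchSwinnertonDyer-20094 (moot, gen 2) — named by an active item. -/
def ManinFrameResidueClass : Prop :=
  PublishedInputsAdditiveKoly → ∀ (W : WeierstrassCurve ℚ) [W.IsElliptic] [W.IsGloballyMinimal] (p : ℕ) [Fact p.Prime] [NeZero (W.conductorNorm ℤ)], 5 ≤ p → Literature.NumberTheory.EllipticCurves.Rank1Residual.Addv W p → Literature.NumberTheory.EllipticCurves.Rank1Residual.Irr W p → ((p < 11 ∨ ∃ (W' : WeierstrassCurve ℚ) (_ : W'.IsElliptic) (_ : W'.IsGloballyMinimal), WeierstrassCurve.IsIsogenous W W' ∧ Summit.BirchSwinnertonDyer.Rank1Residual.Additive.TypeGOrd W' p ∧ padicValInt p W'.minimalDiscriminantInt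 ≤ 4) ∧ (∃ (W' : WeierstrassCurve ℚ) (_ : W'.IsElliptic) (_ : W'.IsGloballyMinimal), WeierstrassCurve.IsIsogenous W W' ∧ ∀ (v : IsDedekindDomain.HeightOneSpectrum ℤ) (n : ℕ), Rat.HeightOneSpectrum.natGenerator v = p → W'.kodairaSymbolAt v ≠ Literature.NumberTheory.DiophantineGeometry.KodairaSymbol.Istar n)) → W.analyticRank = 1 → ∃ (K : Type) (_ : Field K) (_ : NumberField K) (Dt : Literature.NumberTheory.EllipticCurves.ModularForms.ModularParametrizationData W (W.conductorNorm ℤ)) (H : Literature.NumberTheory.EllipticCurves.HeegnerDatum (W.conductorNorm ℤ) (NumberField.discr K)) (ι : K →+* ℂ) (P : (W.baseChange K).toAffine.Point) (Wd : WeierstrassCurve ℚ) (_ : Wd.IsElliptic) (_ : Wd.IsGloballyMinimal) (Cd : WeierstrassCurve.VariableChange ℚ), Literature.NumberTheory.EllipticCurves.IsImaginaryQuadratic K ∧ Odd (NumberField.discr K) ∧ ¬ (p : ℤ) ∣ NumberField.discr K ∧ Literature.NumberTheory.EllipticCurves.SatisfiesHeegnerHypothesis (W.conductorNorm ℤ)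 K ∧ WeierstrassCurve.Affine.Point.map ι.toRatAlgHom P = Literature.NumberTheory.EllipticCurves.ModularForms.heegnerPointComplex Dt H ∧ ¬ (p : ℤ) ∣ Dt.c ∧ ¬ p ∣ NumberField.Units.torsionOrder K ∧ (W.quadraticTwist (NumberField.discr K : ℚ)).entireLFunction 1 ≠ 0 ∧ Cd • W.quadraticTwist (NumberField.discr K : ℚ) = Wd

-- parent: PublishedInputsAdditiveKoly · child (gen 1)
/--     item stmt-BirchSwinnertonDyer-19921 · support · rank 901 · open
    parent: PublishedInputsAdditiveKoly · by operator
    sources: GrossZagier1986, Kolyvagin1990, Darmon2004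
[support] The one PUBLISHED input the halves-glue consumes: Gross–Zagier–Kolyvagin, rank = analytic
rank for analytic rank ≤ 1 with Ш finite (tree named fact
rank_eq_analyticRank_of_analyticRank_le_one; used by bsdp_of_missingPPartAt to turn Miller's last
clause into BSD(E,2)). Carried as a displayed PUB hypothesis; never counted as progress. The further
PRINT of the roads to the two halves (Greenberg Thm-4.1 analogues at a multiplicative prime
thm41Analogue_charValue_rankZero_numberField_anyPrime / …_split_baseChange_anyPrime, modularity) and
the referee-passed MEMO inputs (Kato ⊗ℚ at a multiplicative 2:
X5.O1.KatoMultiplicativeDivisibilityRat W 2, HOME mult/PROOF-MULT.md RC-2; Greenberg–Stevens at 2: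
greenberg_stevens W 2, mult/PROOF-GS2.md RC-4) enter the LINES under the halves (bridge
multiplicativeRankZeroAtTwo_of_muRoad, p409679), not this glue. -/
@[route_item "route-BirchSwinnertonDyer-AdditiveKolyvaginRoad"]
def RankEqAnalyticRankLeOne : Prop :=
  Literature.NumberTheory.EllipticCurves.rank_eq_analyticRank_of_analyticRank_le_one

-- parent: PublishedInputsAdditiveKoly · child (gen 1)
/--     item stmt-BirchSwinnertonDyer-19273 · support · rank 902 · open
    parent: PublishedInputsAdditiveKoly · by planner
    sources: BCDTJAMS2001, DiamondShurman2005
[support] entire continuation of L(E/ℚ, s) (modularity: Breuil–Conrad–Diamond–Taylor 2001 Thm A +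
Hecke/Shimura), BY NAME — conjunct of MultConversePublishedInputsAtTwo (19185); same content, filed
so the head constant is item-stated (#15c one rule; cite_only dep) -/
@[route_item "route-BirchSwinnertonDyer-AdditiveKolyvaginRoad"]
def EntireLFunctionRat : Prop :=
  WeierstrassCurve.hasEntireLFunction_rat

-- parent: PublishedInputsAdditiveKoly · child (gen 1)
/--     item stmt-BirchSwinnertonDyer-19382 · support · rank 903 · open
    parent: PublishedInputsAdditiveKoly · by planner
    sources: BCDTJAMS2001, DiamondShurman2005
[support] Modularity Theorem, Version L (Diamond–Shurman 2005 Thm. 8.8.3; Wiles / Taylor–Wiles /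
BCDT 2001 Thm. A): every E/ℚ has a weight-2 newform f of level N_E with L(f,s) = L(E,s) — conjunct
of PublishedInputsFive (stmt-BirchSwinnertonDyer-19066), BY NAME; same content, filed as a split
child so the head constant is item-stated (gate5 #15c one rule / readiness rule 2026-08-15: a
cite_only dep must be declared by the route); no crux statement / closes / tribunal / tribunal_fit
change -/
@[route_item "route-BirchSwinnertonDyer-AdditiveKolyvaginRoad"]
def NewformOfEllipticCurve : Prop :=
  Literature.NumberTheory.EllipticCurves.ModularForms.exists_isNewformOf

-- parent: PublishedInputsAdditiveKoly · child (gen 1)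
/--     item stmt-BirchSwinnertonDyer-19372 · support · rank 904 · open
    parent: PublishedInputsAdditiveKoly · by planner
    sources: HoffsteinLuo1997
[aside] Hoffstein–Luo 1997 Theorem (§1, pp. 435–436), as used in Matsuno 2009 proof of Prop. 6.1: a
quadratic twist with L(E^D,1) ≠ 0 under prescribed local conditions — conjunct of
PublishedInputsFive (stmt-BirchSwinnertonDyer-19066) kept inside the k = 7 rest child
ClassicalAndTwistInputsFive and item-stated here BY NAME as an ASIDE (banked context, never staffed,
BC6-exempt) so the cite_only dep is declared (#15c); no crux statement / closes / tribunal change -/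
@[route_item "route-BirchSwinnertonDyer-AdditiveKolyvaginRoad"]
def HoffsteinLuoNonvanishingTwist : Prop :=
  Literature.NumberTheory.EllipticCurves.HoffsteinLuo1997_exists_twist_L_one_ne_zero

-- parent: PublishedInputsAdditiveKoly · child (gen 1)
/--     item stmt-BirchSwinnertonDyer-19414 · support · rank 905 · open
    parent: PublishedInputsAdditiveKoly · by operator
    sources: McCallumLMS1991, Kolyvagin1991
[support] McCallum 1991 (LMS LN 153) §5 Cor. 5.6 (p. 310), M_r and Lemma 5.1 (p. 303), Thm. 5.4 (p.
308), §4 S_r(M) (pp. 299–300); Kolyvagin 1991 Math. Ann. §1 B(E) p. 254; Gross 1991 §4 (4.1): the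
Kolyvagin–McCallum structure bound p^{…} ∣ #Ш[p^∞] from a derived-class certificate — conjunct of
PublishedInputsKolyThree (stmt-BirchSwinnertonDyer-19156), BY NAME; same content, filed as a split
child so the head constant is item-stated (gate5 #15c one rule / readiness rule 2026-08-15: a
cite_only dep must be declared by the route); no crux statement / closes / tribunal / tribunal_fit
change -/
@[route_item "route-BirchSwinnertonDyer-AdditiveKolyvaginRoad"]
def McCallumShaStructureCertificate : Prop :=
  Literature.NumberTheory.EllipticCurves.McCallum1991_pow_dvd_card_sha_primary_of_certificate

-- parent: PublishedInputsAdditiveKoly · child (gen 1)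
/--     item stmt-BirchSwinnertonDyer-20170 · support · rank 906 · open
    parent: PublishedInputsAdditiveKoly · by planner
    sources: GrossZagier1986, Kolyvagin1990, Kolyvagin1991, Gross1984HeegnerPoints, Darmon2004
[support] the five PARAMETRISED published inputs of the kernel as one conjunction (Gross–Zagier
formula, Kolyvagin's finiteness, Kolyvagin 1990 upper bound on #Ш[p^∞], Galois conjugation of the
conductor-1 Heegner point (Gross 1984 §§3–4), φ(τ) ∈ E(H_K) (CM theory)) — predicates, cited by
name; closed by citation. -/
@[route_item "route-BirchSwinnertonDyer-AdditiveKolyvaginRoad"]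
def ParametrisedInputsAdditiveKoly : Prop :=
  (∀ (N : ℕ) [NeZero N] (W : WeierstrassCurve ℚ) (K : Type) [Field K] [NumberField K], Literature.NumberTheory.EllipticCurves.gross_zagier N W K) ∧ (∀ (N : ℕ) [NeZero N] (W : WeierstrassCurve ℚ) (K : Type) [Field K] [NumberField K], Literature.NumberTheory.EllipticCurves.kolyvagin N W K) ∧ (∀ (N : ℕ) [NeZero N] (W : WeierstrassCurve ℚ) (K : Type) [Field K] [NumberField K], Literature.NumberTheory.EllipticCurves.Kolyvagin1990_padicValNat_card_sha_le N W K) ∧ (∀ (N : ℕ) [NeZero N] (W : WeierstrassCurve ℚ) (K : Type) [Field K] [NumberField K], Literature.NumberTheory.EllipticCurves.heegnerPointOfConductor_one_galoisConj N W K) ∧ (∀ (N : ℕ) [NeZero N] (W : WeierstrassCurve ℚ) (K : Type) [Field K] [NumberField K], Literature.NumberTheory.EllipticCurves.phi_heegnerTau_mem_range_map_singularModuliField N W K)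

-- parent: PublishedInputsAdditiveKoly · glue (gen 1)
/--     item stmt-BirchSwinnertonDyer-20171 · support · rank 907 · closed · proved by Summit.BirchSwinnertonDyer.BirchSwinnertonDyer.Theorems.AdditiveKoly.publishedInputsAdditiveKolyGlue (prover)
    parent: PublishedInputsAdditiveKoly · GLUE: children ⟹ parent · by planner
pure logic: PublishedInputsAdditiveKoly is the conjunction of the five item-stated closed facts
(rank = r_an ≤ 1, L entire, newform, Hoffstein–Luo, McCallum) and the parametrised five
(ParametrisedInputsAdditiveKoly); reassemble (term checked in the planner's split_sketch.lean) -/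
@[route_item "route-BirchSwinnertonDyer-AdditiveKolyvaginRoad"]
def PublishedInputsAdditiveKolyGlue : Prop :=
  RankEqAnalyticRankLeOne → EntireLFunctionRat → NewformOfEllipticCurve → HoffsteinLuoNonvanishingTwist → McCallumShaStructureCertificate → ParametrisedInputsAdditiveKoly → PublishedInputsAdditiveKoly

-- `PublishedInputsAdditiveKolyGlue` holds: proved by `Summit.BirchSwinnertonDyer.BirchSwinnertonDyer.Theorems.AdditiveKoly.publishedInputsAdditiveKolyGlue` (its module imports this route file, so no `_holds` link can be stated here).

/-- item stmt-BirchSwinnertonDyer-20136 · crux · rank 6 · closed · proved by Summit.BirchSwinnertonDyer.BirchSwinnertonDyer.Theorems.AdditiveKolyvaginRoad.ManinGoodOddFrameAdditive_proof (prover) · by planner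
why it might fail: Open only on the Edixhoven residue: p ∈ {5,7} (his method allows 5, 7 ∣ c) and p ≥ 11 pot-ordinary of Kodaira type II/III/IV (Edixhoven 1991 Thm 3: p ∣ c at most once); elsewhere at p ≥ 11 the frame is provable now (child ManinFrameOffEdixhovenException).
sources: EdixhovenManin1991, HoffsteinLuo1997, arXiv:1911.09446, AgasheRibetStein2006, Cesnavicius2018, Darmon2004
earlier split gen 1: ManinEdixhovenInputs, ManinFrameOffEdixhovenException, ManinFrameOnEdixhovenResidue — retired stmt-BirchSwinnertonDyer-20279, stmt-BirchSwinnertonDyer-20280, stmt-BirchSwinnertonDyer-20281, stmt-BirchSwinnertonDyer-20282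
retired/moot children: MazurManinConstantOddPrimes [moot: Literature.NumberTheory.EllipticCurves.ModularForms.mazur_not_dvd_maninConstant_]; EdixhovenManinKodairaType [moot: Literature.NumberTheory.EllipticCurves.ModularForms.edixhoven_not_dvd_maninConst]; AbbesUllmoManinConstantGoodPrimes [moot: Literature.NumberTheory.EllipticCurves.ModularForms.abbesUllmo_not_dvd_maninCons]; CesnaviciusManinConstantAtTwo [moot: Literature.NumberTheory.EllipticCurves.ModularForms.cesnavicius_not_two_dvd_mani]; ManinFrameResidueClass [moot: PublishedInputsAdditiveKoly → ∀ (W : WeierstrassCurve ℚ) [W.IsElliptic] [W.IsGlo]; ManinEdixhovenInputs [retired: Literature.NumberTheory.EllipticCurves.ModularForms.edixhoven_not_dvd_maninConst]; ManinFrameOffEdixhovenException [retired: ManinEdixhovenInputs → PublishedInputsAdditiveKoly → ∀ (W : WeierstrassCurve ℚ) ]; ManinFrameOnEdixhovenResidue [retired: PublishedInputsAdditiveKoly → ∀ (W : WeierstrassCurve ℚ) [W.IsElliptic] [W.IsGlo]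
[crux] MANIN-GOOD ODD FRAMES EXIST: given the published inputs (Hoffstein–Luo, newforms), at every
additive p ≥ 5 with E[p] irreducible and r_an = 1 there is a Hoffstein–Luo field K (d_K ≡ 1 mod 8
odd, every ℓ ∣ N split, p ∤ d_K, L(E^(d_K),1) ≠ 0, w_K prime to p), a modular parametrisation of W
with Manin constant PRIME TO p, its Heegner point y_K ∈ E(K) and a minimal model of the twist — the
shape of `X11b.exists_oddHeegnerData` without `Mult` (there Mazur's p² ∤ 4N gave p ∤ c). [deps:
PublishedInputsAdditiveKoly] [difficulty: M] -/
@[route_item "route-BirchSwinnertonDyer-AdditiveKolyvaginRoad"]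
def ManinGoodOddFrameAdditive : Prop :=
  PublishedInputsAdditiveKoly → ∀ (W : WeierstrassCurve ℚ) [W.IsElliptic] [W.IsGloballyMinimal] (p : ℕ) [Fact p.Prime] [NeZero (W.conductorNorm ℤ)], 5 ≤ p → Literature.NumberTheory.EllipticCurves.Rank1Residual.Addv W p → Literature.NumberTheory.EllipticCurves.Rank1Residual.Irr W p → W.analyticRank = 1 → ∃ (K : Type) (_ : Field K) (_ : NumberField K) (Dt : Literature.NumberTheory.EllipticCurves.ModularForms.ModularParametrizationData W (W.conductorNorm ℤ)) (H : Literature.NumberTheory.EllipticCurves.HeegnerDatum (W.conductorNorm ℤ) (NumberField.discr K)) (ι : K →+* ℂ) (P : (W.baseChange K).toAffine.Point) (Wd : WeierstrassCurve ℚ) (_ : Wd.IsElliptic) (_ : Wd.IsGloballyMinimal) (Cd : WeierstrassCurve.VariableChange ℚ), Literature.NumberTheory.EllipticCurves.IsImaginaryQuadratic K ∧ Odd (NumberField.discr K) ∧ ¬ (p : ℤ) ∣ NumberField.discr K ∧ Literature.NumberTheory.EllipticCurves.SatisfiesHeegnerHypothesis (W.conductorNorm ℤ) K ∧ WeierstrassCurve.Affine.Point.map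 ι.toRatAlgHom P = Literature.NumberTheory.EllipticCurves.ModularForms.heegnerPointComplex Dt H ∧ ¬ (p : ℤ) ∣ Dt.c ∧ ¬ p ∣ NumberField.Units.torsionOrder K ∧ (W.quadraticTwist (NumberField.discr K : ℚ)).entireLFunction 1 ≠ 0 ∧ Cd • W.quadraticTwist (NumberField.discr K : ℚ) = Wd

-- `ManinGoodOddFrameAdditive` holds: proved by `Summit.BirchSwinnertonDyer.BirchSwinnertonDyer.Theorems.AdditiveKolyvaginRoad.ManinGoodOddFrameAdditive_proof` (its module imports this route file, so no `_holds` link can be stated here).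

-- parent: ManinGoodOddFrameAdditive · child (gen 2)
/--     item stmt-BirchSwinnertonDyer-20092 · support · rank 606 · closed · proved by Summit.BirchSwinnertonDyer.BirchSwinnertonDyer.Theorems.ManinFrameOffExceptionClass.maninFrameOffExceptionClass_proof (prover)
    parent: ManinGoodOddFrameAdditive · by planner
    sources: EdixhovenManin1991, HoffsteinLuo1997
[support] PROVABLE NOW (M): the Manin-good odd Heegner frame datum (p ∤ c(Dt) for a parametrisation
datum of W, Heegner field K with p ∤ d_K u_K, L(E^{d_K},1) ≠ 0, minimal model of the twist) for
every AKR frame (W, p) with p ≥ 11, additive at p, E[p] irreducible, r_an = 1, whose WHOLE ℚ-isogeny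
class lies off Edixhoven's exception locus (every minimal W' ~ W: not potentially-good-ordinary at
p, or ord_p Δ_min(W') > 4). Road (akr-p2's plan): strong curve W₀ in the class
(`X12.exists_isIsogenous_optimal`) → Edixhoven by name at W₀
(`Addv.not_dvd_maninConstant_of_exception`, hypotheses 1–2) → prime-to-p transport
`X11b.exists_int_mul_mem_lattice_not_dvd` / `exists_modularParametrizationData_not_dvd` →
Hoffstein–Luo field. The predicate is CLASS-quantified because `4 < ord_p Δ_min` is not
isogeny-invariant inside the tree (`kodaira_le_four_iff_of_isIsogenous_of_typeG` carries v + v′ ≠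
12; under Irr it is, by Dokchitser–Dokchitser, «Local invariants of isogenous elliptic curves»,
Trans. AMS 2015, Table 1 — print only, no bib key yet); replaces 20280
`ManinFrameOffEdixhovenException` (same content, W-predicate → class-predicate; akr-p2 flag
2026-08-27T06:11Z). [difficulty: M] -/
@[route_item "route-BirchSwinnertonDyer-AdditiveKolyvaginRoad", crux]
def ManinFrameOffExceptionClass : Prop :=
  EdixhovenManinNonPotOrdinary → EdixhovenManinKodairaType → PublishedInputsAdditiveKoly → ∀ (W : WeierstrassCurve ℚ) [W.IsElliptic] [W.IsGloballyMinimal] (p : ℕ) [Fact p.Prime] [NeZero (W.conductorNorm ℤ)], 11 ≤ p → Literature.NumberTheory.EllipticCurves.Rank1Residual.Addv W p → Literature.NumberTheory.EllipticCurves.Rank1Residual.Irr W p → (∀ (W' : WeierstrassCurve ℚ) [W'.IsElliptic] [W'.IsGloballyMinimal], WeierstrassCurve.IsIsogenous W W' → (¬ Summit.BirchSwinnertonDyer.Rank1Residual.Additive.TypeGOrd W' p ∨ 4 < padicValInt p W'.minimalDiscriminantInt)) → W.analyticRank = 1 → ∃ (K : Type) (_ : Field K) (_ : NumberField K) (Dt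 : Literature.NumberTheory.EllipticCurves.ModularForms.ModularParametrizationData W (W.conductorNorm ℤ)) (H : Literature.NumberTheory.EllipticCurves.HeegnerDatum (W.conductorNorm ℤ) (NumberField.discr K)) (ι : K →+* ℂ) (P : (W.baseChange K).toAffine.Point) (Wd : WeierstrassCurve ℚ) (_ : Wd.IsElliptic) (_ : Wd.IsGloballyMinimal) (Cd : WeierstrassCurve.VariableChange ℚ), Literature.NumberTheory.EllipticCurves.IsImaginaryQuadratic K ∧ Odd (NumberField.discr K) ∧ ¬ (p : ℤ) ∣ NumberField.discr K ∧ Literature.NumberTheory.EllipticCurves.SatisfiesHeegnerHypothesis (W.conductorNorm ℤ) K ∧ WeierstrassCurve.Affine.Point.map ι.toRatAlgHom P = Literature.NumberTheory.EllipticCurves.ModularForms.heegnerPointComplex Dt H ∧ ¬ (p : ℤ) ∣ Dt.c ∧ ¬ p ∣ NumberField.Units.torsionOrder K ∧ (W.quadraticTwist (NumberField.discr K : ℚ)).entireLFunction 1 ≠ 0 ∧ Cd • W.quadraticTwist (NumberField.discr K : ℚ) = Wd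

-- `ManinFrameOffExceptionClass` holds: proved by `Summit.BirchSwinnertonDyer.BirchSwinnertonDyer.Theorems.ManinFrameOffExceptionClass.maninFrameOffExceptionClass_proof` (its module imports this route file, so no `_holds` link can be stated here).

-- parent: ManinGoodOddFrameAdditive · child (gen 2)
/--     item stmt-BirchSwinnertonDyer-20093 · support · rank 607 · closed · proved by Summit.BirchSwinnertonDyer.BirchSwinnertonDyer.Theorems.ManinFrameIstarClass.maninFrameIstarClass_proof (prover)
    parent: ManinGoodOddFrameAdditive · by planner
    sources: EdixhovenManin1991, Stevens1989, Mazur1978, AbbesUllmo1996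
[support] PROVABLE NOW (M): the same Manin-good frame datum for every AKR frame (W, p), p ≥ 5, whose
whole ℚ-isogeny class has Kodaira type Iₙ* (some n ≥ 0) at the place of ℤ under p — the e = 2 cells:
quadratic twists of good curves (I₀*) and of multiplicative curves (Iₙ*, ν ≥ 1, potentially
multiplicative) — INCLUDING p ∈ {5, 7}: by the tree theorem
`Literature.NumberTheory.EllipticCurves.ModularForms.not_dvd_maninConstant_of_kodairaSymbolAt_eq_Istar`
(Edixhoven 1991 §1 «Mazur–Stevens» clause with Stevens 1989 L.(5.2)/(5.4) PROVED in the tree; valid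
at every odd prime, no p > 7) at the strong curve W₀, modulo the by-name facts 3–5 and modularity
(`exists_isNewformOf`, inside PublishedInputsAdditiveKoly), then the same prime-to-p transport as
the off-exception child (lane-2 re-keying `WAll.maninDatum_of_kodairaSymbolAt_eq_Istar`, ty-2
2026-08-27T06:07Z). Class-quantified for the same transport reason (under Irr, Iₙ* is
class-invariant by Dokchitser–Dokchitser 2015, print only, no bib key yet). [difficulty: M] -/
@[route_item "route-BirchSwinnertonDyer-AdditiveKolyvaginRoad", crux]
def ManinFrameIstarClass : Prop :=
  MazurManinConstantOddPrimes → AbbesUllmoManinConstantGoodPrimes → CesnaviciusManinConstantAtTwo → PublishedInputsAdditiveKoly → ∀ (W : WeierstrassCurve ℚ) [W.IsElliptic] [W.IsGloballyMinimal] (p : ℕ) [Fact p.Prime] [NeZero (W.conductorNorm ℤ)], 5 ≤ p → Literature.NumberTheory.EllipticCurves.Rank1Residual.Addv W p → Literature.NumberTheory.EllipticCurves.Rank1Residual.Irr W p → (∀ (W' : WeierstrassCurve ℚ) [W'.IsElliptic] [W'.IsGloballyMinimal], WeierstrassCurve.IsIsogenous W W' → ∃ (v : IsDedekindDomain.HeightOneSpectrum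 ℤ) (n : ℕ), Rat.HeightOneSpectrum.natGenerator v = p ∧ W'.kodairaSymbolAt v = Literature.NumberTheory.DiophantineGeometry.KodairaSymbol.Istar n) → W.analyticRank = 1 → ∃ (K : Type) (_ : Field K) (_ : NumberField K) (Dt : Literature.NumberTheory.EllipticCurves.ModularForms.ModularParametrizationData W (W.conductorNorm ℤ)) (H : Literature.NumberTheory.EllipticCurves.HeegnerDatum (W.conductorNorm ℤ) (NumberField.discr K)) (ι : K →+* ℂ) (P : (W.baseChange K).toAffine.Point) (Wd : WeierstrassCurve ℚ) (_ : Wd.IsElliptic) (_ : Wd.IsGloballyMinimal) (Cd : WeierstrassCurve.VariableChange ℚ), Literature.NumberTheory.EllipticCurves.IsImaginaryQuadratic K ∧ Odd (NumberField.discr K) ∧ ¬ (p : ℤ) ∣ NumberField.discr K ∧ Literature.NumberTheory.EllipticCurves.SatisfiesHeegnerHypothesis (W.conductorNorm ℤ) K ∧ WeierstrassCurve.Affine.Point.map ι.toRatAlgHom P = Literature.NumberTheory.EllipticCurves.ModularForms.heegnerPointComplex Dt H ∧ ¬ (p : ℤ) ∣ Dt.c ∧ ¬ p ∣ NumberField.Units.torsionOrder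 K ∧ (W.quadraticTwist (NumberField.discr K : ℚ)).entireLFunction 1 ≠ 0 ∧ Cd • W.quadraticTwist (NumberField.discr K : ℚ) = Wd

-- `ManinFrameIstarClass` holds: proved by `Summit.BirchSwinnertonDyer.BirchSwinnertonDyer.Theorems.ManinFrameIstarClass.maninFrameIstarClass_proof` (its module imports this route file, so no `_holds` link can be stated here).

-- parent: ManinGoodOddFrameAdditive · glue (gen 2)
/--     item stmt-BirchSwinnertonDyer-20095 · support · rank 609 · closed · proved by Summit.BirchSwinnertonDyer.BirchSwinnertonDyer.Theorems.ManinGoodOddFrameAdditiveResplitGlue.maninGoodOddFrameAdditiveResplitGlue_proof (prover)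
    parent: ManinGoodOddFrameAdditive · GLUE: children ⟹ parent · by planner
pure logic: case split on the two CLOSED class loci (Kodaira Iₙ* throughout the isogeny class →
ManinFrameIstarClass; p ≥ 11 ∧ class off Edixhoven's exception → ManinFrameOffExceptionClass; else
ManinFrameResidueClass); term checked in planner g2's ManinResplitSketch.g2.lean (resplitGlue_holds,
rc 0, 0 sorries) -/
@[route_item "route-BirchSwinnertonDyer-AdditiveKolyvaginRoad", crux]
def ManinGoodOddFrameAdditiveResplitGlue : Prop :=
  EdixhovenManinNonPotOrdinary → EdixhovenManinKodairaType → MazurManinConstantOddPrimes → AbbesUllmoManinConstantGoodPrimes → CesnaviciusManinConstantAtTwo → ManinFrameOffExceptionClass → ManinFrameIstarClass → ManinFrameResidueClass → ManinGoodOddFrameAdditive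

-- `ManinGoodOddFrameAdditiveResplitGlue` holds: proved by `Summit.BirchSwinnertonDyer.BirchSwinnertonDyer.Theorems.ManinGoodOddFrameAdditiveResplitGlue.maninGoodOddFrameAdditiveResplitGlue_proof` (its module imports this route file, so no `_holds` link can be stated here).

/-- item stmt-BirchSwinnertonDyer-20483 · aside · rank 7 · open · by planner
why it might fail: It IS Manin's conjecture (p-part) where every tool in print is silent: p² ∣ N kills Mazur/AU inseparability, types II/III/IV pot-ordinary (or p ≤ 7) are Edixhoven's exceptions, and p ∣ deg φ voids ČNS; true curve-by-curve in Cremona's tables only.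
sources: EdixhovenManin1991, CesnaviciusNeururerSaha2023, AgasheRibetStein2006, Cesnavicius2018
[crux] (= hypothesis `hProper` of the landed
`…Theorems.ManinFrameResidueClass.maninFrameResidueClass_of_cns_of_proper`, p523401) the PROPER
Manin residue of the additive road: 20094's frame datum for frames (W, p) (p ≥ 5, Addv, Irr,
Edixhoven-exception clause, no Iₙ* member) such that EVERY parametrisation datum of EVERY minimal
member W' ~ W at level N(W) has p ∣ deg — equivalently p ∣ deg φ₀ at the X₀(N)-optimal curve
(p528365 `forall_dvd_modularDegree_iff_dvd_optimal`). = p-part of Manin's c = 1 exactly where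
neither Edixhoven (p > 7, off types II/III/IV), nor Mazur/AU (p² ∤ N), nor ČNS (p ∤ deg) reaches;
55.6 % of the ♯ residue keys (48 942 ♯; p = 5: II/III/IV(*) cells, p = 7, p ≥ 11 ordinary
II/III/IV). TOP-LEVEL item bound by `closes` directly (tenure g4, rev 10); it is THE open Manin
content of the route (supersedes child 20094 = DegreeClass ∧ Proper). On this road the Manin p-part
is necessary (primitivity ⇒ #Ш_p = I(Dt)_p²; GZ+BSD ⇒ Ш_an = I²/(c² ∏c_v u² …)). -/
@[route_item "route-BirchSwinnertonDyer-AdditiveKolyvaginRoad"]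
def ManinFrameResidueProper : Prop :=
  PublishedInputsAdditiveKoly → ∀ (W : WeierstrassCurve ℚ) [W.IsElliptic] [W.IsGloballyMinimal] (p : ℕ) [Fact p.Prime] [NeZero (W.conductorNorm ℤ)], 5 ≤ p → Literature.NumberTheory.EllipticCurves.Rank1Residual.Addv W p → Literature.NumberTheory.EllipticCurves.Rank1Residual.Irr W p → ((p < 11 ∨ ∃ (W' : WeierstrassCurve ℚ) (_ : W'.IsElliptic) (_ : W'.IsGloballyMinimal), WeierstrassCurve.IsIsogenous W W' ∧ Summit.BirchSwinnertonDyer.Rank1Residual.Additive.TypeGOrd W' p ∧ padicValInt p W'.minimalDiscriminantInt ≤ 4) ∧ (∃ (W' : WeierstrassCurve ℚ) (_ : W'.IsElliptic) (_ : W'.IsGloballyMinimal), WeierstrassCurve.IsIsogenous W W' ∧ ∀ (v : IsDedekindDomain.HeightOneSpectrum ℤ) (n : ℕ), Rat.HeightOneSpectrum.natGenerator v = p → W'.kodairaSymbolAt v ≠ Literature.NumberTheory.DiophantineGeometry.KodairaSymbol.Istar n)) → (∀ (W' : WeierstrassCurve ℚ) [W'.IsElliptic] [W'.IsGloballyMinimal]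 (D' : Literature.NumberTheory.EllipticCurves.ModularForms.ModularParametrizationData W' (W.conductorNorm ℤ)), WeierstrassCurve.IsIsogenous W W' → p ∣ D'.modularDegree) → W.analyticRank = 1 → ∃ (K : Type) (_ : Field K) (_ : NumberField K) (Dt : Literature.NumberTheory.EllipticCurves.ModularForms.ModularParametrizationData W (W.conductorNorm ℤ)) (H : Literature.NumberTheory.EllipticCurves.HeegnerDatum (W.conductorNorm ℤ) (NumberField.discr K)) (ι : K →+* ℂ) (P : (W.baseChange K).toAffine.Point) (Wd : WeierstrassCurve ℚ) (_ : Wd.IsElliptic) (_ : Wd.IsGloballyMinimal) (Cd : WeierstrassCurve.VariableChange ℚ), Literature.NumberTheory.EllipticCurves.IsImaginaryQuadratic K ∧ Odd (NumberField.discr K) ∧ ¬ (p : ℤ) ∣ NumberField.discr K ∧ Literature.NumberTheory.EllipticCurves.SatisfiesHeegnerHypothesis (W.conductorNorm ℤ) K ∧ WeierstrassCurve.Affine.Point.map ι.toRatAlgHom P = Literature.NumberTheory.EllipticCurves.ModularForms.heegnerPointComplex Dt H ∧ ¬ (p : ℤ) ∣ Dt.c ∧ ¬ p ∣ NumberField.Units.torsionOrder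 K ∧ (W.quadraticTwist (NumberField.discr K : ℚ)).entireLFunction 1 ≠ 0 ∧ Cd • W.quadraticTwist (NumberField.discr K : ℚ) = Wd

/-- item stmt-BirchSwinnertonDyer-20138 · support · rank 9 · closed · proved by Summit.BirchSwinnertonDyer.BirchSwinnertonDyer.Theorems.AdditiveKolyvaginKernel.additiveKolyvaginKernel_proof (prover) · by planner
sources: WZhang2014, McCallumLMS1991, GrossZagier1986, Kolyvagin1991, Miller2011LMS
[support] the ADDITIVE KOLYVAGIN KERNEL: published inputs → Manin-good odd frames → the crux → the
rank-zero residual → BSD_p for every ♯ rank-one additive row at p ≥ 5 (p-generic clone of the landed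
p = 3 kernel `Koly.bsdp_three_onA1_of_kolyvaginFramesHL`: frame ∘ Darmon 3.6 datum ∘ GZ non-torsion
∘ Kolyvagin ∘ E(K)[p] = 0 ∘ crux ∘ McCallum ⇒ IndexLowerBoundAt ⇒ identity ⇒
`X11b.bsdp_of_indexIdentityAt`, the twist's p-part from the rank-zero residual via `pPart_of_bsdp`).
[difficulty: L] -/
@[route_item "route-BirchSwinnertonDyer-AdditiveKolyvaginRoad", crux]
def AdditiveKolyvaginKernel : Prop :=
  PublishedInputsAdditiveKoly → ManinGoodOddFrameAdditive → KolyvaginPrimitiveAdditive → RankZeroAdditive → ∀ (W : WeierstrassCurve ℚ) [W.IsElliptic] [W.IsGloballyMinimal] (p : ℕ) [Fact p.Prime], ¬ W.HasCM → 5 ≤ p → Literature.NumberTheory.EllipticCurves.Rank1Residual.Addv W p → W.analyticRank = 1 → W.HasSurjectiveModNGaloisRep p → (∀ (ℓ : ℕ) [Fact ℓ.Prime], W.HasMultiplicativeReductionAtPrime ℓ → ¬ p ∣ padicValInt ℓ W.minimalDiscriminantInt) → (∃ (ℓ₁ ℓ₂ : ℕ) (_ : Fact ℓ₁.Prime) (_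 : Fact ℓ₂.Prime), ℓ₁ ≠ ℓ₂ ∧ W.HasMultiplicativeReductionAtPrime ℓ₁ ∧ W.HasMultiplicativeReductionAtPrime ℓ₂) → ¬ p ∣ W.tamagawaProduct → Literature.NumberTheory.EllipticCurves.BSDp W p

-- `AdditiveKolyvaginKernel` holds: proved by `Summit.BirchSwinnertonDyer.BirchSwinnertonDyer.Theorems.AdditiveKolyvaginKernel.additiveKolyvaginKernel_proof` (its module imports this route file, so no `_holds` link can be stated here).

/-- item stmt-BirchSwinnertonDyer-20481 · support · rank 9 · open · by planner
sources: CesnaviciusNeururerSaha2023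
[support] BY NAME, cite_only input: Česnavičius–Neururer–Saha 2024 Thm 1.2 — v_p(c(D)) ≤ v_p(deg D)
for every modular parametrisation datum D of level N(W) of an elliptic curve over ℚ and every prime
p ≥ 5 (`cesnaviciusNeururerSaha_padicVal_maninConstant_le_modularDegree`). Item-stated (readiness
rule 2026-08-15). [difficulty: hypothesis-only] -/
@[route_item "route-BirchSwinnertonDyer-AdditiveKolyvaginRoad", crux]
def CesnaviciusNeururerSahaManinDegree : Prop :=
  Literature.NumberTheory.EllipticCurves.ModularForms.cesnaviciusNeururerSaha_padicVal_maninConstant_le_modularDegree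

/-- item stmt-BirchSwinnertonDyer-20482 · support · rank 9 · closed · proved by Summit.BirchSwinnertonDyer.BirchSwinnertonDyer.Theorems.ManinFrameResidueDegreeClass.maninFrameResidueDegreeClass_proof (prover) · by planner
sources: CesnaviciusNeururerSaha2023, HoffsteinLuo1997
[support] the Manin-residue frame (child 20094 `ManinFrameResidueClass`'s statement) on the
DEGREE-FREE SUB-LOCUS — some minimal W' ~ W carries a parametrisation datum D' at level N(W) with p
∤ deg(D') — modulo ČNS (antecedent). TOP-LEVEL item bound by `closes` directly (tenure g4, rev 10:
the gate renderer cannot yet re-split 20136 — survivor-order bug, director (19) 11:44:27Z); with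
`CesnaviciusNeururerSahaManinDegree` and `ManinFrameResidueProper` it yields 20094 by pure logic
(`residue_of_children`, SimS.lean rc 0). Closes AT ONCE by
`…Theorems.ManinFrameResidueClass.frame_of_degreeClass` (akr-p2 p523401; 2-line term). 44.4 % of the
♯ residue keys N < 5·10⁵ (census d70ffdc336a9f529). -/
@[route_item "route-BirchSwinnertonDyer-AdditiveKolyvaginRoad", crux]
def ManinFrameResidueDegreeClass : Prop :=
  Literature.NumberTheory.EllipticCurves.ModularForms.cesnaviciusNeururerSaha_padicVal_maninConstant_le_modularDegree → PublishedInputsAdditiveKoly → ∀ (W : WeierstrassCurve ℚ) [W.IsElliptic] [W.IsGloballyMinimal] (p : ℕ) [Fact p.Prime] [NeZero (W.conductorNorm ℤ)], 5 ≤ p → Literature.NumberTheory.EllipticCurves.Rank1Residual.Addv W p → Literature.NumberTheory.EllipticCurves.Rank1Residual.Irr W p → ((p < 11 ∨ ∃ (W' : WeierstrassCurve ℚ) (_ : W'.IsElliptic) (_ : W'.IsGloballyMinimal), WeierstrassCurve.IsIsogenous W W' ∧ Summit.BirchSwinnertonDyer.Rank1Residual.Additive.TypeGOrd W' p ∧ padicValInt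 p W'.minimalDiscriminantInt ≤ 4) ∧ (∃ (W' : WeierstrassCurve ℚ) (_ : W'.IsElliptic) (_ : W'.IsGloballyMinimal), WeierstrassCurve.IsIsogenous W W' ∧ ∀ (v : IsDedekindDomain.HeightOneSpectrum ℤ) (n : ℕ), Rat.HeightOneSpectrum.natGenerator v = p → W'.kodairaSymbolAt v ≠ Literature.NumberTheory.DiophantineGeometry.KodairaSymbol.Istar n)) → (∃ (W' : WeierstrassCurve ℚ) (_ : W'.IsElliptic) (_ : W'.IsGloballyMinimal) (D' : Literature.NumberTheory.EllipticCurves.ModularForms.ModularParametrizationData W' (W.conductorNorm ℤ)), WeierstrassCurve.IsIsogenous W W' ∧ ¬ p ∣ D'.modularDegree) → W.analyticRank = 1 → ∃ (K : Type) (_ : Field K) (_ : NumberField K) (Dt : Literature.NumberTheory.EllipticCurves.ModularForms.ModularParametrizationData W (W.conductorNorm ℤ)) (H : Literature.NumberTheory.EllipticCurves.HeegnerDatum (W.conductorNorm ℤ) (NumberField.discr K)) (ι : K →+* ℂ) (P : (W.baseChange K).toAffine.Point) (Wd : WeierstrassCurve ℚ) (_ : Wd.IsElliptic) (_ : Wd.IsGloballyMinimal)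 (Cd : WeierstrassCurve.VariableChange ℚ), Literature.NumberTheory.EllipticCurves.IsImaginaryQuadratic K ∧ Odd (NumberField.discr K) ∧ ¬ (p : ℤ) ∣ NumberField.discr K ∧ Literature.NumberTheory.EllipticCurves.SatisfiesHeegnerHypothesis (W.conductorNorm ℤ) K ∧ WeierstrassCurve.Affine.Point.map ι.toRatAlgHom P = Literature.NumberTheory.EllipticCurves.ModularForms.heegnerPointComplex Dt H ∧ ¬ (p : ℤ) ∣ Dt.c ∧ ¬ p ∣ NumberField.Units.torsionOrder K ∧ (W.quadraticTwist (NumberField.discr K : ℚ)).entireLFunction 1 ≠ 0 ∧ Cd • W.quadraticTwist (NumberField.discr K : ℚ) = Wd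

-- `ManinFrameResidueDegreeClass` holds: proved by `Summit.BirchSwinnertonDyer.BirchSwinnertonDyer.Theorems.ManinFrameResidueDegreeClass.maninFrameResidueDegreeClass_proof` (its module imports this route file, so no `_holds` link can be stated here).

/-- item stmt-BirchSwinnertonDyer-20708 · support · rank 9 · closed · proved by Summit.BirchSwinnertonDyer.BirchSwinnertonDyer.Theorems.InputsSweep.additiveKolyvaginRoad_dokchitserIsogenyMinimalDiscriminant_proof (prover) · by planner
[support] BY NAME, cite-only: Dokchitser–Dokchitser, «Local invariants of isogenous elliptic
curves», Trans. AMS 367 (2015) Thm 5.1 (1), clause l ≠ p — an isogeny of degree prime to p preserves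
v_p(Δ_min) at a prime of potentially good reduction (Literature fact
dokchitser_padicValInt_minimalDiscriminantInt_eq_of_isogeny_of_not_dvd_degree, PUBLISHED);
item-stated antecedent 3 of ManinFrameResidueProperR (TYPING-CHECKLIST T10: printed black boxes are
antecedents stated by an item); hypothesis-only, never asserted. sources:
DokchitserDokchitser2015LocalInvariants -/
@[route_item "route-BirchSwinnertonDyer-AdditiveKolyvaginRoad", crux]
def DokchitserIsogenyMinimalDiscriminant : Prop :=
  Literature.NumberTheory.EllipticCurves.dokchitser_padicValInt_minimalDiscriminantInt_eq_of_isogeny_of_not_dvd_degree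

-- `DokchitserIsogenyMinimalDiscriminant` holds: proved by `Summit.BirchSwinnertonDyer.BirchSwinnertonDyer.Theorems.InputsSweep.additiveKolyvaginRoad_dokchitserIsogenyMinimalDiscriminant_proof` (its module imports this route file, so no `_holds` link can be stated here).

/-- item stmt-BirchSwinnertonDyer-20709 · crux (kind.auto-crux: conjecture-grade) · rank 7 · closed · proved by Summit.BirchSwinnertonDyer.BirchSwinnertonDyer.Theorems.AdditiveKolyvaginRoad.ManinFrameResidueProperR_proof (prover) · by planner
why it might fail: It IS Manin's p-part on Edixhoven's exceptional locus: at p ≥ 11 equivalent (p540328) to the Manin-free twist-degree step TDS, open in print (ČNS 2024 §1; Edixhoven Thm 3 = at most once), known only curve-by-curve (Cremona c₀ = 1, N ≤ 5·10⁵); one optimal curve with p ∣ c₀ beyond the tables kills it.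
sources: EdixhovenManin1991, CesnaviciusNeururerSaha2023, AgasheRibetStein2006, DokchitserDokchitser2015LocalInvariants, Cesnavicius2018
[crux] = ManinFrameResidueProper (stmt-BirchSwinnertonDyer-20483) GRANTED its printed antecedents
(TYPING-CHECKLIST T10): Edixhoven 1991 Thm 3 in both tree renderings (route items
EdixhovenManinNonPotOrdinary, EdixhovenManinKodairaType) and Dokchitser–Dokchitser 2015 Thm 5.1(1)
(item DokchitserIsogenyMinimalDiscriminant) → the PROPER Manin residue frame statement verbatim (a
Manin-good odd Heegner frame at every frame (W,p): p ≥ 5 additive, E[p] irreducible, Edixhoven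
exception class without Iₙ* member, every conductor-level datum of every minimal member of degree
divisible by p, r_an = 1). Open content: p ∈ {5,7} — Manin p-part for some minimal member (stub
S57); p ≥ 11 — the Manin-free TWIST-DEGREE STEP TDS (p540328
exists_member_not_dvd_c_iff_twistDegreeStep; lattice form p542525): for the unstarred (G)-ordinary
minimal member V and the minimal model W♭ of V ⊗ χ_{p*}, some conductor-level datum of V has
v_p(deg) below every conductor-level datum of W♭. why it might fail: it IS Manins conjecture
(p-part) on Edixhovens exceptional locus — TDS says Edixhovens §4 case 1 (v_p(c) = 1, deg♭ = deg/p)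
never occurs for pot-ordinary II/III/IV optimal curves at p ≥ 11, which is open in prin -/
@[route_item "route-BirchSwinnertonDyer-AdditiveKolyvaginRoad", crux]
def ManinFrameResidueProperR : Prop :=
  EdixhovenManinNonPotOrdinary → EdixhovenManinKodairaType → DokchitserIsogenyMinimalDiscriminant → PublishedInputsAdditiveKoly → ∀ (W : WeierstrassCurve ℚ) [W.IsElliptic] [W.IsGloballyMinimal] (p : ℕ) [Fact p.Prime] [NeZero (W.conductorNorm ℤ)], 5 ≤ p → Literature.NumberTheory.EllipticCurves.Rank1Residual.Addv W p → Literature.NumberTheory.EllipticCurves.Rank1Residual.Irr W p → ((p < 11 ∨ ∃ (W' : WeierstrassCurve ℚ) (_ : W'.IsElliptic) (_ : W'.IsGloballyMinimal), WeierstrassCurve.IsIsogenous W W' ∧ Summit.BirchSwinnertonDyer.Rank1Residual.Additive.TypeGOrd W' p ∧ padicValInt p W'.minimalDiscriminantInt ≤ 4) ∧ (∃ (W' : WeierstrassCurve ℚ) (_ : W'.IsElliptic) (_ : W'.IsGloballyMinimal), WeierstrassCurve.IsIsogenous W W' ∧ ∀ (v : IsDedekindDomain.HeightOneSpectrum ℤ)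 (n : ℕ), Rat.HeightOneSpectrum.natGenerator v = p → W'.kodairaSymbolAt v ≠ Literature.NumberTheory.DiophantineGeometry.KodairaSymbol.Istar n)) → (∀ (W' : WeierstrassCurve ℚ) [W'.IsElliptic] [W'.IsGloballyMinimal] (D' : Literature.NumberTheory.EllipticCurves.ModularForms.ModularParametrizationData W' (W.conductorNorm ℤ)), WeierstrassCurve.IsIsogenous W W' → p ∣ D'.modularDegree) → W.analyticRank = 1 → ∃ (K : Type) (_ : Field K) (_ : NumberField K) (Dt : Literature.NumberTheory.EllipticCurves.ModularForms.ModularParametrizationData W (W.conductorNorm ℤ)) (H : Literature.NumberTheory.EllipticCurves.HeegnerDatum (W.conductorNorm ℤ) (NumberField.discr K)) (ι : K →+* ℂ) (P : (W.baseChange K).toAffine.Point) (Wd : WeierstrassCurve ℚ) (_ : Wd.IsElliptic) (_ : Wd.IsGloballyMinimal) (Cd : WeierstrassCurve.VariableChange ℚ), Literature.NumberTheory.EllipticCurves.IsImaginaryQuadratic K ∧ Odd (NumberField.discr K) ∧ ¬ (p : ℤ) ∣ NumberField.discr K ∧ Literature.NumberTheory.EllipticCurves.SatisfiesHeegnerHypothesis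 (W.conductorNorm ℤ) K ∧ WeierstrassCurve.Affine.Point.map ι.toRatAlgHom P = Literature.NumberTheory.EllipticCurves.ModularForms.heegnerPointComplex Dt H ∧ ¬ (p : ℤ) ∣ Dt.c ∧ ¬ p ∣ NumberField.Units.torsionOrder K ∧ (W.quadraticTwist (NumberField.discr K : ℚ)).entireLFunction 1 ≠ 0 ∧ Cd • W.quadraticTwist (NumberField.discr K : ℚ) = Wd

-- `ManinFrameResidueProperR` holds: proved by `Summit.BirchSwinnertonDyer.BirchSwinnertonDyer.Theorems.AdditiveKolyvaginRoad.ManinFrameResidueProperR_proof` (its module imports this route file, so no `_holds` link can be stated here).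

-- earlier PublishedDualityInputsAdditiveKoly (stmt-BirchSwinnertonDyer-21267, replaced 2026-08-27T17:54:55Z -> stmt-BirchSwinnertonDyer-21333): retired by None — (∀ (F : Type) [Field F] [NumberField F], WeierstrassCurve.exists_casselsTate_pairing (K := F)) ∧ (∀ (K : Type) [Field K] [NumberField K], Literature.NumberTheory.GaloisCohomology.poitouTate_selmerStructure_duality K)
/-- item stmt-BirchSwinnertonDyer-21333 · aside · rank 9 · closed · proved by Summit.BirchSwinnertonDyer.BirchSwinnertonDyer.Theorems.InputsSweep.additiveKolyvaginRoad_publishedDualityInputsAdditiveKoly_proof (prover) · by planner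
sources: SilvermanAEC2009, MilneADT2006, Rubin2000, MazurRubin2004, Howard2004HeegnerKolyvagin
[support] BY NAME — published duality inputs, the second tranche of the displayed published inputs
(T12: cite-only named facts consumed by an item are stated as an item; bundled as one item under the
15-item cap, like PublishedInputsAdditiveKoly): (1) the Cassels–Tate pairing on Ш(E/F) over number
fields — tree named fact `WeierstrassCurve.exists_casselsTate_pairing` (Cassels 1962, Tate 1963;
Milne ADT I.6.13/6.26; Silverman AEC X.4.14), consumed by the parity step P
(`oddSelmerRankAdditive_of_published`, hypothesis hCT); (2) Poitou–Tate duality for Selmer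
structures — tree named fact
`Literature.NumberTheory.GaloisCohomology.poitouTate_selmerStructure_duality` (Milne ADT I Thm 4.10;
Rubin, Euler Systems, Thm 1.7.3; Mazur–Rubin 2004 Thm 2.3.4; Howard 2004), consumed by (Supply) ⟹
LOC (`kolyvaginLocalPackageP_of_supply` p540947). Both PUBLISHED; never counted as progress; the
gate may hold it like 20708; closes when the two Literature facts are proved in the tree. -/
@[route_item "route-BirchSwinnertonDyer-AdditiveKolyvaginRoad", crux]
def PublishedDualityInputsAdditiveKoly : Prop :=
  (∀ (K : Type) [Field K] [NumberField K], Literature.NumberTheory.EllipticCurves.casselsTate_levelInputs K) ∧ (∀ (K : Type) [Field K] [NumberField K], Literature.NumberTheory.GaloisCohomology.poitouTate_selmerStructure_duality K)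

-- `PublishedDualityInputsAdditiveKoly` holds: proved by `Summit.BirchSwinnertonDyer.BirchSwinnertonDyer.Theorems.InputsSweep.additiveKolyvaginRoad_publishedDualityInputsAdditiveKoly_proof` (its module imports this route file, so no `_holds` link can be stated here).

-- earlier BottomRankOneAdditive (stmt-BirchSwinnertonDyer-21265, replaced 2026-08-27T19:01:50Z -> stmt-BirchSwinnertonDyer-21397): retired by None — ∀ (W : WeierstrassCurve ℚ) [W.IsElliptic] [W.IsGloballyMinimal] [NeZero (W.conductorNorm ℤ)] (p : ℕ) [Fact p.Prime] (K : Type) [Field K] [NumberField K] (Dt : Literature.NumberTheory.EllipticCurves.ModularForms.ModularParametrizationData W (W.conductorN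
/-- item stmt-BirchSwinnertonDyer-21397 · aside · rank 10 · open · by planner
why it might fail: It IS Kolyvagin's conjecture (bottom case) at an additive p: the definite-side rank-0 converse for the level-raised form of E's type is unproved at p² ∣ N (SU ∕ Skinner–Zhang need p ∤ N or p ∥ N; Fouquet–Wan is a preprint needing a non-split ρ̄-ramified Steinberg prime the frame lacks).
sources: WZhang2014, SkinnerZhang2014, arXiv:2107.13726, arXiv:0810.1877, GrossLMS1991, doi:10.1007/s00222-013-0448-1
[crux] BOT — PROMOTED STUB (line `birth` v8 `stub_bottomRankOneAdditive`, verbatim): Kolyvagin's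
conjecture mod p AT THE BOTTOM in p-Selmer rank one at an additive p ≥ 5: at every ♯ additive frame
with #Sel_p(E/K) = p, the conductor-1 Kolyvagin–Heegner class c(1) = δ y_K is non-zero in H¹(K,
E[p]) (witness pinned n = 1). = Zhang Thm 7.2 for g = f_E itself at level N with p² ∣ N: one
type-preserving level raising at a BD-admissible q₁ (Gee Cor 3.1.7), rank lowering Sel_{q₁} = 0
(E-side, Zhang Prop 5.4 — tree rank-lowering A1 landed at general p), the RANK-0 ANCHOR «Sel = 0 ⇒
L^alg(g₁/K, 1) unit» for the level-raised DEFINITE-side form g₁ of E's additive type, the period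
bridge and the first reciprocity law loc_{q₁} c(1) ≐ L^alg. The same open input as KS's base case,
at the lowest level; per type it is carried by the by-type children 20418/20419's bottom mechanisms
(tame branch g_ε ∕ twisted Brandt module for abelian type; type-σ(τ) Brandt module for cuspidal
type). In print only for p ∤ N (Zhang 2014 Thm 7.2 ⇐ Thm 7.1 = SU) and p ∥ N (Skinner–Zhang 2014);
at p² ∣ N the anchor is the Fouquet–Wan preprint claim on its locus and nothing beyond. [difficulty:
open-problem] -/
@[route_item "route-BirchSwinnertonDyer-AdditiveKolyvaginRoad", crux]
def BottomRankOneAdditive : Prop :=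
  ∀ (W : WeierstrassCurve ℚ) [W.IsElliptic] [W.IsGloballyMinimal] [NeZero (W.conductorNorm ℤ)] (p : ℕ) [Fact p.Prime] (K : Type) [Field K] [NumberField K] (Dt : Literature.NumberTheory.EllipticCurves.ModularForms.ModularParametrizationData W (W.conductorNorm ℤ)) (β : ℤ) (ι : K →+* ℂ), 5 ≤ p → Literature.NumberTheory.EllipticCurves.Rank1Residual.Addv W p → W.HasSurjectiveModNGaloisRep p → (∀ (ℓ : ℕ) [Fact ℓ.Prime], W.HasMultiplicativeReductionAtPrime ℓ → ¬ p ∣ padicValInt ℓ W.minimalDiscriminantInt) → (∃ (ℓ₁ ℓ₂ : ℕ) (_ : Fact ℓ₁.Prime) (_ : Fact ℓ₂.Prime), ℓ₁ ≠ ℓ₂ ∧ W.HasMultiplicativeReductionAtPrime ℓ₁ ∧ W.HasMultiplicativeReductionAtPrime ℓ₂) → ¬ p ∣ W.tamagawaProduct → W.analyticRank = 1 → Literature.NumberTheory.EllipticCurves.IsImaginaryQuadratic K → Odd (NumberField.discr K) → NumberField.discr K < -4 → Literature.NumberTheory.EllipticCurves.SatisfiesHeegnerHypothesis (W.conductorNorm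 ℤ) K → (W.quadraticTwist (NumberField.discr K : ℚ)).entireLFunction 1 ≠ 0 → (4 * (W.conductorNorm ℤ : ℤ)) ∣ β ^ 2 - NumberField.discr K → ¬ (p : ℤ) ∣ Dt.c → Nat.card (WeierstrassCurve.selmerGroup (W.baseChange K) (p : ℤ)) = p → ∃ d : Literature.NumberTheory.EllipticCurves.KolyvaginHeegnerData Dt β ι 1, d.kolyvaginClass (Fact.out : p.Prime) 1 ≠ 0

/-- item stmt-BirchSwinnertonDyer-21266 · support · rank 9 · closed · proved by Summit.BirchSwinnertonDyer.BirchSwinnertonDyer.Theorems.AdditiveKoly.kolyvaginPrimitiveOfLevelSystemsAdditive_proof (prover) · by planner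
sources: WZhang2014, GrossLMS1991, MilneADT2006, McCallum1991
[support] THE E-SIDE COMPOSITION (line `birth` v8 of crux r2, lead akr-p1:
`KolyvaginPrimitiveAdditive_of` is kernel-checked modulo its stubs): granted the displayed published
inputs (PUB), the published duality inputs BY NAME (Cassels–Tate pairing, Poitou–Tate duality for
Selmer structures: item PublishedDualityInputsAdditiveKoly), the LEVEL SYSTEMS (KS) and the BOTTOM
(BOT) give the primitivity crux `KolyvaginPrimitiveAdditive`: parity P (#Sel = p^s, s odd — LANDED
`oddSelmerRankAdditive_of_published`, needs GZ + Kolyvagin + modularity from PUB and Cassels–Tate),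
s = 1 ⇒ BOT + `kolSupp_one`, s ≥ 3 ⇒ rank lowering A1 (LANDED
`AdditiveKoly.stub_rankLoweringAdditive`) + the LOCAL PACKAGE LOC (`Nonempty (KolyvaginLocalPackageP
…)`: reduced to (Supply) alone, p540947; (Supply) ⇐ Poitou–Tate fact + IsoBound p546163 + hw p547100
+ Lag-tr p547854 + toric Lagrangian and the jump/signed/assembly chain in port —
HOME/bsd-wall-akr-p1/NOTES_g3.md §PORT MAP) + the ENGINE (LANDED `inductionGivenRankLowering_of` ∘
`ZhangTriangulation…oddStart`). Provable E-side Galois cohomology; the akr-p1 lineage's target once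
LOC lands (import the skeleton's composition). Caveat flagged 2026-08-27 (tenure g7 -/
@[route_item "route-BirchSwinnertonDyer-AdditiveKolyvaginRoad"]
def KolyvaginPrimitiveOfLevelSystemsAdditive : Prop :=
  PublishedInputsAdditiveKoly → PublishedDualityInputsAdditiveKoly → LevelKolyvaginSystemsAdditive → BottomRankOneAdditive → KolyvaginPrimitiveAdditive

-- `KolyvaginPrimitiveOfLevelSystemsAdditive` holds: proved by `Summit.BirchSwinnertonDyer.BirchSwinnertonDyer.Theorems.AdditiveKoly.kolyvaginPrimitiveOfLevelSystemsAdditive_proof` (its module imports this route file, so no `_holds` link can be stated here).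

/-- item stmt-BirchSwinnertonDyer-20139 · assembly · rank 1 · closed · proved by Summit.BirchSwinnertonDyer.BirchSwinnertonDyer.Theorems.AdditiveKoly.assembly (prover) · by planner
sources: WZhang2014, Miller2011LMS
[assembly] KolyvaginPrimitiveAdditive → RankZeroAdditive → OffSharpRankOneAdditive → AdditiveAtThree
→ ManinGoodOddFrameAdditive → PublishedInputsAdditiveKoly → AdditiveKolyvaginKernel →
WAllExclAdditive (the registered W-ALL leaf, row 2). -/
@[route_item "route-BirchSwinnertonDyer-AdditiveKolyvaginRoad"]
def Assembly : Prop :=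
  KolyvaginPrimitiveAdditive → RankZeroAdditive → OffSharpRankOneAdditive → AdditiveAtThree → ManinGoodOddFrameAdditive → PublishedInputsAdditiveKoly → AdditiveKolyvaginKernel → Summit.BirchSwinnertonDyer.WAllExclAdditive

-- `Assembly` holds: proved by `Summit.BirchSwinnertonDyer.BirchSwinnertonDyer.Theorems.AdditiveKoly.assembly` (its module imports this route file, so no `_holds` link can be stated here).

/-! D-0027 §2.1 — DECIDING THEOREM (planner-authored via `route open/edit --closes-file`; by planner-bsd-wall-add-g9-0 2026-08-28T10:43:21Z):
its hypotheses are this route's items and its conclusion the registered leaf `Summit.BirchSwinnertonDyer.WAllExclAdditive` (rung W-ALL/2, D-0061) (glue_lint), and it elaborates with this file. -/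

@[closes "route-BirchSwinnertonDyer-AdditiveKolyvaginRoad"] theorem closes (h₁ : KolyvaginPrimitiveAdditive) (h₀ : RankZeroAdditive)
    (hoff : OffSharpRankOneAdditive) (h₃ : AdditiveAtThree)
    (e1 : EdixhovenManinNonPotOrdinary) (e2 : EdixhovenManinKodairaType)
    (dd : DokchitserIsogenyMinimalDiscriminant)
    (mz : MazurManinConstantOddPrimes) (au : AbbesUllmoManinConstantGoodPrimes)
    (c2 : CesnaviciusManinConstantAtTwo) (hOff : ManinFrameOffExceptionClass)
    (hIst : ManinFrameIstarClass) (g95 : ManinGoodOddFrameAdditiveResplitGlue)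
    (hC : CesnaviciusNeururerSahaManinDegree) (hD : ManinFrameResidueDegreeClass)
    (hR : ManinFrameResidueProperR) (hP : PublishedInputsAdditiveKoly)
    (hK : AdditiveKolyvaginKernel) :
    Summit.BirchSwinnertonDyer.WAllExclAdditive := by
  -- (α) 2026-08-28 (director-bsd g13 l.707 / cruxtriage-21396-1 g17 #50): the primitivity crux `KolyvaginPrimitiveAdditive` (KPA′, r2)
  -- is BOUND DIRECTLY; KS′ / BOT (its former upstream via the proved E-side composition 21266) are corollary/banked, not load-bearing
  -- the Manin residue (former crux `ManinFrameResidueClass`) from ČNS + degree-free class + proper residue GRANTED e1 e2 dd: pure logic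
  have hRes : ManinFrameResidueClass := by
    intro hP' W _ _ p _ _ h5 hadd hirr hcl hr1
    by_cases hex : ∃ (W' : WeierstrassCurve ℚ) (_ : W'.IsElliptic) (_ : W'.IsGloballyMinimal)
        (D' : Literature.NumberTheory.EllipticCurves.ModularForms.ModularParametrizationData W' (W.conductorNorm ℤ)),
        WeierstrassCurve.IsIsogenous W W' ∧ ¬ p ∣ D'.modularDegree
    · exact hD hC hP' W p h5 hadd hirr hcl hex hr1
    · refine hR e1 e2 dd hP' W p h5 hadd hirr hcl ?_ hr1
      intro W' _ _ D' hiso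
      by_contra hnd
      exact hex ⟨W', ‹_›, ‹_›, D', hiso, hnd⟩
  -- the Manin-good odd frame (crux `ManinGoodOddFrameAdditive`) by the proved gen-2 glue over the proved class loci
  have hM : ManinGoodOddFrameAdditive := g95 e1 e2 mz au c2 hOff hIst hRes
  intro W _ _ p _ hCM hp2 hadd hr
  have hp : p.Prime := Fact.out
  by_cases hp3 : p = 3
  · subst hp3
    exact h₃ W hCM hadd hr
  · have hp5 : 5 ≤ p := hp.five_le_of_ne_two_of_ne_three hp2 hp3
    rcases Nat.lt_or_ge W.analyticRank 1 with hr0 | hr1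
    · exact h₀ W p hCM hp5 hadd (by omega)
    · have hr1' : W.analyticRank = 1 := le_antisymm hr hr1
      by_cases hsharp : (W.HasSurjectiveModNGaloisRep p ∧
          (∀ (ℓ : ℕ) [Fact ℓ.Prime], W.HasMultiplicativeReductionAtPrime ℓ →
            ¬ p ∣ padicValInt ℓ W.minimalDiscriminantInt) ∧
          (∃ (ℓ₁ ℓ₂ : ℕ) (_ : Fact ℓ₁.Prime) (_ : Fact ℓ₂.Prime), ℓ₁ ≠ ℓ₂ ∧
            W.HasMultiplicativeReductionAtPrime ℓ₁ ∧ W.HasMultiplicativeReductionAtPrime ℓ₂) ∧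
          ¬ p ∣ W.tamagawaProduct)
      · obtain ⟨hs, hsp, htwo, htam⟩ := hsharp
        exact hK hP hM h₁ h₀ W p hCM hp5 hadd hr1' hs hsp htwo htam
      · exact hoff W p hCM hp5 hadd hr1' hsharp

end Summit.BirchSwinnertonDyer.BirchSwinnertonDyer.Theses.AdditiveKolyvaginRoad
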